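import Literature.AlgebraicGeometry.HodgeTheory.RibetTypeSixtySevenfoldPowersHodgeClasses
import Literature.AlgebraicGeometry.Motives.HodgeThetaSubalgebraUnitaryNineFiftyEightCore
import Literature.AlgebraicGeometry.Motives.HodgeThetaSubalgebraUnitaryTenFiftySevenCore
import Literature.AlgebraicGeometry.Motives.HodgeThetaSubalgebraUnitaryTwelveFiftyFiveCore
import Literature.AlgebraicGeometry.Motives.HodgeThetaSubalgebraUnitaryFifteenFiftyTwoCore
import Literature.AlgebraicGeometry.Motives.HodgeThetaSubalgebraUnitarySixteenFiftyOneCore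
import Literature.AlgebraicGeometry.Motives.HodgeThetaSubalgebraUnitarySeventeenFiftyCore
import Literature.AlgebraicGeometry.Motives.HodgeThetaSubalgebraUnitaryEighteenFortyNineCore
import Literature.AlgebraicGeometry.Motives.HodgeThetaSubalgebraUnitaryNineteenFortyEightCore
import Literature.AlgebraicGeometry.Motives.HodgeThetaSubalgebraUnitaryTwentyOneFortySixCore
import Literature.AlgebraicGeometry.Motives.HodgeThetaSubalgebraUnitaryTwentyTwoFortyFiveCore
import Literature.AlgebraicGeometry.Motives.HodgeThetaSubalgebraUnitaryTwentyThreeFortyFourCore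
import Literature.AlgebraicGeometry.Motives.HodgeThetaSubalgebraUnitaryTwentyFiveFortyTwoCore
import Literature.AlgebraicGeometry.Motives.HodgeThetaSubalgebraUnitaryTwentySevenFortyCore
import Literature.AlgebraicGeometry.Motives.HodgeThetaSubalgebraUnitaryTwentyEightThirtyNineCore
import Literature.AlgebraicGeometry.Motives.HodgeThetaSubalgebraUnitaryTwentyNineThirtyEightCore
import Literature.AlgebraicGeometry.Motives.HodgeThetaSubalgebraUnitaryThirtyOneThirtySixCore
import Literature.AlgebraicGeometry.Motives.HodgeThetaSubalgebraUnitaryThirtyTwoThirtyFiveCore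
import Literature.AlgebraicGeometry.Motives.HodgeThetaSubalgebraUnitaryThirtyThreeThirtyFourCore
import HarnessLib

/-!
# Hodge classes on all powers of abelian varieties of Ribet type `(9, 58)`, `(10, 57)`, `(12, 55)`, `(15, 52)`, `(16, 51)`, `(17, 50)`, `(18, 49)`, `(19, 48)`, `(21, 46)`, `(22, 45)`, `(23, 44)`, `(25, 42)`, `(27, 40)`, `(28, 39)`, `(29, 38)`, `(31, 36)`, `(32, 35)`, `(33, 34)`
# are generated by divisor classes (Ribet 1983 Thm. 3 at these multiplicities, by the MINIMAL-RANK method —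
# UNCONDITIONAL); EVERY SIMPLE COMPLEX ABELIAN 67-FOLD WITH `End⁰ ≠ ℚ`

Family `hodge`, layer `Literature/AlgebraicGeometry/HodgeTheory`. Research context: cell `pub-hodge-ring2` (HONEST
FRAMING: research route conditional on HC_CM; not a corollary; Q11.4-sentence-2 already refuted in dim ≥ 3),
Literature lane gen 89. UNCONDITIONAL for the class of abelian varieties it names; theorems only, no definition, no
named fact (D-0026), no `sorry`. The CELLS of the generic assembly `RibetTypeOfCoreSmulPowersHodgeClasses` at the
minimal-rank cores `Unitary….eq_top_of_smul` of the eleven `p = 67` cells with bad raising ranks (settled rank by rank: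
a full small Levi algebra and lifts killed in the large one, two pencils, exclusive Levi profiles, TOOL C, the
orthogonal-chain count `UnitaryOrthogonalChain.false_of_constProfile(_pos)`, constant-rank sub-Levi lemmas, the mirror
`−Θ` and raising-rank sub-families), and the conclusion of the census `isDivisorGenerated_powSucc_of_isSimple_sixtysevenfold`:
with all eleven residual `k`-signatures `{9, 58}`, `{10, 57}`, `{12, 55}`, `{15, 52}`, `{16, 51}`, `{17, 50}`, `{18, 49}`, `{19, 48}`, `{21, 46}`, `{22, 45}`, `{23, 44}`, `{25, 42}`, `{27, 40}`, `{28, 39}`, `{29, 38}`, `{31, 36}`, `{32, 35}`, `{33, 34}` supplied, every simple complex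
abelian `67`-fold with `End⁰ ≠ ℚ` has `B• = D•` and the Hodge conjecture on all powers — `p = 67` COMPLETE, as
`p = 17, …, 43` before it (`RibetTypeTwentyOneTwentyTwoPowersHodgeClasses`).

THE PRINTED THEOREM. Ribet, Amer. J. Math. 105 (1983), Thm. 3 = Gordon's survey Thm. 6.3 (3) [held
`paper:arxiv-alg-geom_9709030` p. 18]: for an abelian variety `A` with `End⁰(A)` an imaginary quadratic field `K` acting
with relatively prime multiplicities `(n′, n″)`, `Hg(A) = Lf(A)` and the Hodge ring of every power of `A` is generated by
divisors (ibid. Thm. 6.2 = Ribet Thm. 0).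

* §1 the cells `(9, 58)`, `(10, 57)`, `(12, 55)`, `(15, 52)`, `(16, 51)`, `(17, 50)`, `(18, 49)`, `(19, 48)`, `(21, 46)`, `(22, 45)`, `(23, 44)`, `(25, 42)`, `(27, 40)`, `(28, 39)`, `(29, 38)`, `(31, 36)`, `(32, 35)`, `(33, 34)` (and mirrors), the Hodge conjecture for these
  powers, 67-FOLDS of these signatures.
* §2 `isDivisorGenerated_powSucc_of_isSimple_sixtysevenfold'` (granted only `End⁰ = ℚ`),
  `isDivisorGenerated_powSucc_of_isSimple_sixtysevenfold_of_finrank_endAlgebra_ne_one`,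
  `hodgeConjectureFor_powSucc_of_isSimple_sixtysevenfold_of_finrank_endAlgebra_ne_one`.

## References
* [Ribet1983] K. A. Ribet, Amer. J. Math. 105 (1983), Thm. 0 and Thm. 3.
* [Gordon1997] B. B. Gordon, *A survey of the Hodge conjecture for abelian varieties*, Thm. 6.3 (3) and Corollary.
* [MoonenZarhin1999LowDim] B. Moonen, Yu. Zarhin, Math. Ann. 315 (1999), §2 (2.4), Thm. (2.7).
* [Deligne2000] P. Deligne, *The Hodge conjecture* (Clay, 2000), §1.
-/

noncomputable section

open CategoryTheory Module

namespace Literature.AlgebraicGeometry.HodgeTheory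

open Literature.AlgebraicGeometry.Motives
open Literature.AlgebraicGeometry.Motives.HodgeStructure

section Cells

/-- **Ribet 1983 Thm. 3 at `(n′, n″) = (9, 58)` — UNCONDITIONAL** (core `UnitaryNineFiftyEight.eq_top_of_smul`).
[cite: Ribet1983, Thm. 0 and Thm. 3] [cite: Gordon1997, Thm. 6.3 (3) and Corollary] -/
theorem AbelianVariety.isDivisorGenerated_powSucc_of_ribetTypeNineFiftyEight (A : AbelianVariety ℂ) (φ : A ⟶ A)
    {d : ℕ} (hd : 0 < d) (hφ : φ ≫ φ = -(d • 𝟙 A)) (hE2 : Module.finrank ℚ A.endAlgebra = 2)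
    (h9 : eigenMultiplicity A φ (Complex.I * (Real.sqrt d : ℂ)) = 9)
    (h58 : eigenMultiplicity A φ (-(Complex.I * (Real.sqrt d : ℂ))) = 58) (N : ℕ) :
    IsDivisorGenerated (A.powSucc N) := by
  refine AbelianVariety.isDivisorGenerated_powSucc_of_ribetType_ofCoreSmul A φ hd hφ hE2 (by omega) (by omega) ?_ N
  intro W' _ _ _ 𝔊 ι P' Q' s hbr hirr hι hιι hP' hQ' hfinP' hfinQ' hadd hsmul hsymm hPQ hdefP hdefQ hadj
  exact UnitaryNineFiftyEight.eq_top_of_smul hbr hirr hι hιι hP' hQ' (by rw [hfinP', h9]) (by rw [hfinQ', h58]) hadd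
    hsmul hsymm hPQ hdefP hdefQ hadj

/-- The mirror: `n_{i√d}(φ) = 58`, `n_{−i√d}(φ) = 9` (core `UnitaryNineFiftyEight.eq_top_of_smul'`).
[cite: Ribet1983, Thm. 0 and Thm. 3] [cite: Gordon1997, Thm. 6.3 (3) and Corollary] -/
theorem AbelianVariety.isDivisorGenerated_powSucc_of_ribetTypeNineFiftyEight' (A : AbelianVariety ℂ) (φ : A ⟶ A)
    {d : ℕ} (hd : 0 < d) (hφ : φ ≫ φ = -(d • 𝟙 A)) (hE2 : Module.finrank ℚ A.endAlgebra = 2)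
    (h58 : eigenMultiplicity A φ (Complex.I * (Real.sqrt d : ℂ)) = 58)
    (h9 : eigenMultiplicity A φ (-(Complex.I * (Real.sqrt d : ℂ))) = 9) (N : ℕ) :
    IsDivisorGenerated (A.powSucc N) := by
  refine AbelianVariety.isDivisorGenerated_powSucc_of_ribetType_ofCoreSmul A φ hd hφ hE2 (by omega) (by omega) ?_ N
  intro W' _ _ _ 𝔊 ι P' Q' s hbr hirr hι hιι hP' hQ' hfinP' hfinQ' hadd hsmul hsymm hPQ hdefP hdefQ hadj
  exact UnitaryNineFiftyEight.eq_top_of_smul' hbr hirr hι hιι hP' hQ' (by rw [hfinP', h58]) (by rw [hfinQ', h9])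
    hadd hsmul hsymm hPQ hdefP hdefQ hadj

/-- **The Hodge conjecture for all powers `A^{N+1}` of an abelian variety of Ribet type `(9, 58)` — UNCONDITIONAL.**
[cite: Ribet1983, Thm. 3] [cite: Deligne2000, §1] -/
theorem hodgeConjectureFor_powSucc_of_ribetTypeNineFiftyEight (A : AbelianVariety ℂ) (φ : A ⟶ A)
    {d : ℕ} (hd : 0 < d) (hφ : φ ≫ φ = -(d • 𝟙 A)) (hE2 : Module.finrank ℚ A.endAlgebra = 2)
    (h9 : eigenMultiplicity A φ (Complex.I * (Real.sqrt d : ℂ)) = 9)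
    (h58 : eigenMultiplicity A φ (-(Complex.I * (Real.sqrt d : ℂ))) = 58) (N : ℕ) :
    HodgeConjectureFor (A.powSucc N).dim (A.powSucc N).X :=
  hodgeConjectureFor_of_isDivisorGenerated _
    (AbelianVariety.isDivisorGenerated_powSucc_of_ribetTypeNineFiftyEight A φ hd hφ hE2 h9 h58 N)

/-- **67-FOLDS of signature `{9, 58}`: `B• = D•` on all powers — UNCONDITIONAL** (either eigenvalue may carry the `9`).
[cite: Ribet1983, Thm. 0 and Thm. 3] [cite: MoonenZarhin1999LowDim, §2 (2.4)] -/
theorem AbelianVariety.isDivisorGenerated_powSucc_of_sixtysevenfold_nineFiftyEight (A : AbelianVariety ℂ)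
    (φ : A ⟶ A) {d : ℕ} (hd : 0 < d) (hφ : φ ≫ φ = -(d • 𝟙 A)) (hE2 : Module.finrank ℚ A.endAlgebra = 2)
    (hX : A.dim = 67)
    (h9 : eigenMultiplicity A φ (Complex.I * (Real.sqrt d : ℂ)) = 9 ∨
      eigenMultiplicity A φ (-(Complex.I * (Real.sqrt d : ℂ))) = 9)
    (N : ℕ) : IsDivisorGenerated (A.powSucc N) := by
  have hsum := eigenMultiplicity_add_eigenMultiplicity_neg_eq_dim A φ hd hφ
  rw [hX] at hsum
  rcases h9 with h | h
  · exact AbelianVariety.isDivisorGenerated_powSucc_of_ribetTypeNineFiftyEight A φ hd hφ hE2 h (by omega) N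
  · exact AbelianVariety.isDivisorGenerated_powSucc_of_ribetTypeNineFiftyEight' A φ hd hφ hE2 (by omega) h N

/-- **The Hodge conjecture for all powers of a 67-FOLD of signature `{9, 58}` — UNCONDITIONAL.**
[cite: Ribet1983, Thm. 3] [cite: Deligne2000, §1] -/
theorem hodgeConjectureFor_powSucc_of_sixtysevenfold_nineFiftyEight (A : AbelianVariety ℂ)
    (φ : A ⟶ A) {d : ℕ} (hd : 0 < d) (hφ : φ ≫ φ = -(d • 𝟙 A)) (hE2 : Module.finrank ℚ A.endAlgebra = 2)
    (hX : A.dim = 67)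
    (h9 : eigenMultiplicity A φ (Complex.I * (Real.sqrt d : ℂ)) = 9 ∨
      eigenMultiplicity A φ (-(Complex.I * (Real.sqrt d : ℂ))) = 9)
    (N : ℕ) : HodgeConjectureFor (A.powSucc N).dim (A.powSucc N).X :=
  hodgeConjectureFor_of_isDivisorGenerated _
    (AbelianVariety.isDivisorGenerated_powSucc_of_sixtysevenfold_nineFiftyEight A φ hd hφ hE2 hX h9 N)

/-- **Ribet 1983 Thm. 3 at `(n′, n″) = (10, 57)` — UNCONDITIONAL** (core `UnitaryTenFiftySeven.eq_top_of_smul`).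
[cite: Ribet1983, Thm. 0 and Thm. 3] [cite: Gordon1997, Thm. 6.3 (3) and Corollary] -/
theorem AbelianVariety.isDivisorGenerated_powSucc_of_ribetTypeTenFiftySeven (A : AbelianVariety ℂ) (φ : A ⟶ A)
    {d : ℕ} (hd : 0 < d) (hφ : φ ≫ φ = -(d • 𝟙 A)) (hE2 : Module.finrank ℚ A.endAlgebra = 2)
    (h10 : eigenMultiplicity A φ (Complex.I * (Real.sqrt d : ℂ)) = 10)
    (h57 : eigenMultiplicity A φ (-(Complex.I * (Real.sqrt d : ℂ))) = 57) (N : ℕ) :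
    IsDivisorGenerated (A.powSucc N) := by
  refine AbelianVariety.isDivisorGenerated_powSucc_of_ribetType_ofCoreSmul A φ hd hφ hE2 (by omega) (by omega) ?_ N
  intro W' _ _ _ 𝔊 ι P' Q' s hbr hirr hι hιι hP' hQ' hfinP' hfinQ' hadd hsmul hsymm hPQ hdefP hdefQ hadj
  exact UnitaryTenFiftySeven.eq_top_of_smul hbr hirr hι hιι hP' hQ' (by rw [hfinP', h10]) (by rw [hfinQ', h57]) hadd
    hsmul hsymm hPQ hdefP hdefQ hadj

/-- The mirror: `n_{i√d}(φ) = 57`, `n_{−i√d}(φ) = 10` (core `UnitaryTenFiftySeven.eq_top_of_smul'`).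
[cite: Ribet1983, Thm. 0 and Thm. 3] [cite: Gordon1997, Thm. 6.3 (3) and Corollary] -/
theorem AbelianVariety.isDivisorGenerated_powSucc_of_ribetTypeTenFiftySeven' (A : AbelianVariety ℂ) (φ : A ⟶ A)
    {d : ℕ} (hd : 0 < d) (hφ : φ ≫ φ = -(d • 𝟙 A)) (hE2 : Module.finrank ℚ A.endAlgebra = 2)
    (h57 : eigenMultiplicity A φ (Complex.I * (Real.sqrt d : ℂ)) = 57)
    (h10 : eigenMultiplicity A φ (-(Complex.I * (Real.sqrt d : ℂ))) = 10) (N : ℕ) :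
    IsDivisorGenerated (A.powSucc N) := by
  refine AbelianVariety.isDivisorGenerated_powSucc_of_ribetType_ofCoreSmul A φ hd hφ hE2 (by omega) (by omega) ?_ N
  intro W' _ _ _ 𝔊 ι P' Q' s hbr hirr hι hιι hP' hQ' hfinP' hfinQ' hadd hsmul hsymm hPQ hdefP hdefQ hadj
  exact UnitaryTenFiftySeven.eq_top_of_smul' hbr hirr hι hιι hP' hQ' (by rw [hfinP', h57]) (by rw [hfinQ', h10])
    hadd hsmul hsymm hPQ hdefP hdefQ hadj

/-- **The Hodge conjecture for all powers `A^{N+1}` of an abelian variety of Ribet type `(10, 57)` — UNCONDITIONAL.**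
[cite: Ribet1983, Thm. 3] [cite: Deligne2000, §1] -/
theorem hodgeConjectureFor_powSucc_of_ribetTypeTenFiftySeven (A : AbelianVariety ℂ) (φ : A ⟶ A)
    {d : ℕ} (hd : 0 < d) (hφ : φ ≫ φ = -(d • 𝟙 A)) (hE2 : Module.finrank ℚ A.endAlgebra = 2)
    (h10 : eigenMultiplicity A φ (Complex.I * (Real.sqrt d : ℂ)) = 10)
    (h57 : eigenMultiplicity A φ (-(Complex.I * (Real.sqrt d : ℂ))) = 57) (N : ℕ) :
    HodgeConjectureFor (A.powSucc N).dim (A.powSucc N).X :=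
  hodgeConjectureFor_of_isDivisorGenerated _
    (AbelianVariety.isDivisorGenerated_powSucc_of_ribetTypeTenFiftySeven A φ hd hφ hE2 h10 h57 N)

/-- **67-FOLDS of signature `{10, 57}`: `B• = D•` on all powers — UNCONDITIONAL** (either eigenvalue may carry the `10`).
[cite: Ribet1983, Thm. 0 and Thm. 3] [cite: MoonenZarhin1999LowDim, §2 (2.4)] -/
theorem AbelianVariety.isDivisorGenerated_powSucc_of_sixtysevenfold_tenFiftySeven (A : AbelianVariety ℂ)
    (φ : A ⟶ A) {d : ℕ} (hd : 0 < d) (hφ : φ ≫ φ = -(d • 𝟙 A)) (hE2 : Module.finrank ℚ A.endAlgebra = 2)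
    (hX : A.dim = 67)
    (h10 : eigenMultiplicity A φ (Complex.I * (Real.sqrt d : ℂ)) = 10 ∨
      eigenMultiplicity A φ (-(Complex.I * (Real.sqrt d : ℂ))) = 10)
    (N : ℕ) : IsDivisorGenerated (A.powSucc N) := by
  have hsum := eigenMultiplicity_add_eigenMultiplicity_neg_eq_dim A φ hd hφ
  rw [hX] at hsum
  rcases h10 with h | h
  · exact AbelianVariety.isDivisorGenerated_powSucc_of_ribetTypeTenFiftySeven A φ hd hφ hE2 h (by omega) N
  · exact AbelianVariety.isDivisorGenerated_powSucc_of_ribetTypeTenFiftySeven' A φ hd hφ hE2 (by omega) h N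

/-- **The Hodge conjecture for all powers of a 67-FOLD of signature `{10, 57}` — UNCONDITIONAL.**
[cite: Ribet1983, Thm. 3] [cite: Deligne2000, §1] -/
theorem hodgeConjectureFor_powSucc_of_sixtysevenfold_tenFiftySeven (A : AbelianVariety ℂ)
    (φ : A ⟶ A) {d : ℕ} (hd : 0 < d) (hφ : φ ≫ φ = -(d • 𝟙 A)) (hE2 : Module.finrank ℚ A.endAlgebra = 2)
    (hX : A.dim = 67)
    (h10 : eigenMultiplicity A φ (Complex.I * (Real.sqrt d : ℂ)) = 10 ∨
      eigenMultiplicity A φ (-(Complex.I * (Real.sqrt d : ℂ))) = 10)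
    (N : ℕ) : HodgeConjectureFor (A.powSucc N).dim (A.powSucc N).X :=
  hodgeConjectureFor_of_isDivisorGenerated _
    (AbelianVariety.isDivisorGenerated_powSucc_of_sixtysevenfold_tenFiftySeven A φ hd hφ hE2 hX h10 N)

/-- **Ribet 1983 Thm. 3 at `(n′, n″) = (12, 55)` — UNCONDITIONAL** (core `UnitaryTwelveFiftyFive.eq_top_of_smul`).
[cite: Ribet1983, Thm. 0 and Thm. 3] [cite: Gordon1997, Thm. 6.3 (3) and Corollary] -/
theorem AbelianVariety.isDivisorGenerated_powSucc_of_ribetTypeTwelveFiftyFive (A : AbelianVariety ℂ) (φ : A ⟶ A)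
    {d : ℕ} (hd : 0 < d) (hφ : φ ≫ φ = -(d • 𝟙 A)) (hE2 : Module.finrank ℚ A.endAlgebra = 2)
    (h12 : eigenMultiplicity A φ (Complex.I * (Real.sqrt d : ℂ)) = 12)
    (h55 : eigenMultiplicity A φ (-(Complex.I * (Real.sqrt d : ℂ))) = 55) (N : ℕ) :
    IsDivisorGenerated (A.powSucc N) := by
  refine AbelianVariety.isDivisorGenerated_powSucc_of_ribetType_ofCoreSmul A φ hd hφ hE2 (by omega) (by omega) ?_ N
  intro W' _ _ _ 𝔊 ι P' Q' s hbr hirr hι hιι hP' hQ' hfinP' hfinQ' hadd hsmul hsymm hPQ hdefP hdefQ hadj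
  exact UnitaryTwelveFiftyFive.eq_top_of_smul hbr hirr hι hιι hP' hQ' (by rw [hfinP', h12]) (by rw [hfinQ', h55]) hadd
    hsmul hsymm hPQ hdefP hdefQ hadj

/-- The mirror: `n_{i√d}(φ) = 55`, `n_{−i√d}(φ) = 12` (core `UnitaryTwelveFiftyFive.eq_top_of_smul'`).
[cite: Ribet1983, Thm. 0 and Thm. 3] [cite: Gordon1997, Thm. 6.3 (3) and Corollary] -/
theorem AbelianVariety.isDivisorGenerated_powSucc_of_ribetTypeTwelveFiftyFive' (A : AbelianVariety ℂ) (φ : A ⟶ A)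
    {d : ℕ} (hd : 0 < d) (hφ : φ ≫ φ = -(d • 𝟙 A)) (hE2 : Module.finrank ℚ A.endAlgebra = 2)
    (h55 : eigenMultiplicity A φ (Complex.I * (Real.sqrt d : ℂ)) = 55)
    (h12 : eigenMultiplicity A φ (-(Complex.I * (Real.sqrt d : ℂ))) = 12) (N : ℕ) :
    IsDivisorGenerated (A.powSucc N) := by
  refine AbelianVariety.isDivisorGenerated_powSucc_of_ribetType_ofCoreSmul A φ hd hφ hE2 (by omega) (by omega) ?_ N
  intro W' _ _ _ 𝔊 ι P' Q' s hbr hirr hι hιι hP' hQ' hfinP' hfinQ' hadd hsmul hsymm hPQ hdefP hdefQ hadj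
  exact UnitaryTwelveFiftyFive.eq_top_of_smul' hbr hirr hι hιι hP' hQ' (by rw [hfinP', h55]) (by rw [hfinQ', h12])
    hadd hsmul hsymm hPQ hdefP hdefQ hadj

/-- **The Hodge conjecture for all powers `A^{N+1}` of an abelian variety of Ribet type `(12, 55)` — UNCONDITIONAL.**
[cite: Ribet1983, Thm. 3] [cite: Deligne2000, §1] -/
theorem hodgeConjectureFor_powSucc_of_ribetTypeTwelveFiftyFive (A : AbelianVariety ℂ) (φ : A ⟶ A)
    {d : ℕ} (hd : 0 < d) (hφ : φ ≫ φ = -(d • 𝟙 A)) (hE2 : Module.finrank ℚ A.endAlgebra = 2)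
    (h12 : eigenMultiplicity A φ (Complex.I * (Real.sqrt d : ℂ)) = 12)
    (h55 : eigenMultiplicity A φ (-(Complex.I * (Real.sqrt d : ℂ))) = 55) (N : ℕ) :
    HodgeConjectureFor (A.powSucc N).dim (A.powSucc N).X :=
  hodgeConjectureFor_of_isDivisorGenerated _
    (AbelianVariety.isDivisorGenerated_powSucc_of_ribetTypeTwelveFiftyFive A φ hd hφ hE2 h12 h55 N)

/-- **67-FOLDS of signature `{12, 55}`: `B• = D•` on all powers — UNCONDITIONAL** (either eigenvalue may carry the `12`).
[cite: Ribet1983, Thm. 0 and Thm. 3] [cite: MoonenZarhin1999LowDim, §2 (2.4)] -/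
theorem AbelianVariety.isDivisorGenerated_powSucc_of_sixtysevenfold_twelveFiftyFive (A : AbelianVariety ℂ)
    (φ : A ⟶ A) {d : ℕ} (hd : 0 < d) (hφ : φ ≫ φ = -(d • 𝟙 A)) (hE2 : Module.finrank ℚ A.endAlgebra = 2)
    (hX : A.dim = 67)
    (h12 : eigenMultiplicity A φ (Complex.I * (Real.sqrt d : ℂ)) = 12 ∨
      eigenMultiplicity A φ (-(Complex.I * (Real.sqrt d : ℂ))) = 12)
    (N : ℕ) : IsDivisorGenerated (A.powSucc N) := by
  have hsum := eigenMultiplicity_add_eigenMultiplicity_neg_eq_dim A φ hd hφ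
  rw [hX] at hsum
  rcases h12 with h | h
  · exact AbelianVariety.isDivisorGenerated_powSucc_of_ribetTypeTwelveFiftyFive A φ hd hφ hE2 h (by omega) N
  · exact AbelianVariety.isDivisorGenerated_powSucc_of_ribetTypeTwelveFiftyFive' A φ hd hφ hE2 (by omega) h N

/-- **The Hodge conjecture for all powers of a 67-FOLD of signature `{12, 55}` — UNCONDITIONAL.**
[cite: Ribet1983, Thm. 3] [cite: Deligne2000, §1] -/
theorem hodgeConjectureFor_powSucc_of_sixtysevenfold_twelveFiftyFive (A : AbelianVariety ℂ)
    (φ : A ⟶ A) {d : ℕ} (hd : 0 < d) (hφ : φ ≫ φ = -(d • 𝟙 A)) (hE2 : Module.finrank ℚ A.endAlgebra = 2)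
    (hX : A.dim = 67)
    (h12 : eigenMultiplicity A φ (Complex.I * (Real.sqrt d : ℂ)) = 12 ∨
      eigenMultiplicity A φ (-(Complex.I * (Real.sqrt d : ℂ))) = 12)
    (N : ℕ) : HodgeConjectureFor (A.powSucc N).dim (A.powSucc N).X :=
  hodgeConjectureFor_of_isDivisorGenerated _
    (AbelianVariety.isDivisorGenerated_powSucc_of_sixtysevenfold_twelveFiftyFive A φ hd hφ hE2 hX h12 N)

/-- **Ribet 1983 Thm. 3 at `(n′, n″) = (15, 52)` — UNCONDITIONAL** (core `UnitaryFifteenFiftyTwo.eq_top_of_smul`).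
[cite: Ribet1983, Thm. 0 and Thm. 3] [cite: Gordon1997, Thm. 6.3 (3) and Corollary] -/
theorem AbelianVariety.isDivisorGenerated_powSucc_of_ribetTypeFifteenFiftyTwo (A : AbelianVariety ℂ) (φ : A ⟶ A)
    {d : ℕ} (hd : 0 < d) (hφ : φ ≫ φ = -(d • 𝟙 A)) (hE2 : Module.finrank ℚ A.endAlgebra = 2)
    (h15 : eigenMultiplicity A φ (Complex.I * (Real.sqrt d : ℂ)) = 15)
    (h52 : eigenMultiplicity A φ (-(Complex.I * (Real.sqrt d : ℂ))) = 52) (N : ℕ) :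
    IsDivisorGenerated (A.powSucc N) := by
  refine AbelianVariety.isDivisorGenerated_powSucc_of_ribetType_ofCoreSmul A φ hd hφ hE2 (by omega) (by omega) ?_ N
  intro W' _ _ _ 𝔊 ι P' Q' s hbr hirr hι hιι hP' hQ' hfinP' hfinQ' hadd hsmul hsymm hPQ hdefP hdefQ hadj
  exact UnitaryFifteenFiftyTwo.eq_top_of_smul hbr hirr hι hιι hP' hQ' (by rw [hfinP', h15]) (by rw [hfinQ', h52]) hadd
    hsmul hsymm hPQ hdefP hdefQ hadj

/-- The mirror: `n_{i√d}(φ) = 52`, `n_{−i√d}(φ) = 15` (core `UnitaryFifteenFiftyTwo.eq_top_of_smul'`).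
[cite: Ribet1983, Thm. 0 and Thm. 3] [cite: Gordon1997, Thm. 6.3 (3) and Corollary] -/
theorem AbelianVariety.isDivisorGenerated_powSucc_of_ribetTypeFifteenFiftyTwo' (A : AbelianVariety ℂ) (φ : A ⟶ A)
    {d : ℕ} (hd : 0 < d) (hφ : φ ≫ φ = -(d • 𝟙 A)) (hE2 : Module.finrank ℚ A.endAlgebra = 2)
    (h52 : eigenMultiplicity A φ (Complex.I * (Real.sqrt d : ℂ)) = 52)
    (h15 : eigenMultiplicity A φ (-(Complex.I * (Real.sqrt d : ℂ))) = 15) (N : ℕ) :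
    IsDivisorGenerated (A.powSucc N) := by
  refine AbelianVariety.isDivisorGenerated_powSucc_of_ribetType_ofCoreSmul A φ hd hφ hE2 (by omega) (by omega) ?_ N
  intro W' _ _ _ 𝔊 ι P' Q' s hbr hirr hι hιι hP' hQ' hfinP' hfinQ' hadd hsmul hsymm hPQ hdefP hdefQ hadj
  exact UnitaryFifteenFiftyTwo.eq_top_of_smul' hbr hirr hι hιι hP' hQ' (by rw [hfinP', h52]) (by rw [hfinQ', h15])
    hadd hsmul hsymm hPQ hdefP hdefQ hadj

/-- **The Hodge conjecture for all powers `A^{N+1}` of an abelian variety of Ribet type `(15, 52)` — UNCONDITIONAL.**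
[cite: Ribet1983, Thm. 3] [cite: Deligne2000, §1] -/
theorem hodgeConjectureFor_powSucc_of_ribetTypeFifteenFiftyTwo (A : AbelianVariety ℂ) (φ : A ⟶ A)
    {d : ℕ} (hd : 0 < d) (hφ : φ ≫ φ = -(d • 𝟙 A)) (hE2 : Module.finrank ℚ A.endAlgebra = 2)
    (h15 : eigenMultiplicity A φ (Complex.I * (Real.sqrt d : ℂ)) = 15)
    (h52 : eigenMultiplicity A φ (-(Complex.I * (Real.sqrt d : ℂ))) = 52) (N : ℕ) :
    HodgeConjectureFor (A.powSucc N).dim (A.powSucc N).X :=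
  hodgeConjectureFor_of_isDivisorGenerated _
    (AbelianVariety.isDivisorGenerated_powSucc_of_ribetTypeFifteenFiftyTwo A φ hd hφ hE2 h15 h52 N)

/-- **67-FOLDS of signature `{15, 52}`: `B• = D•` on all powers — UNCONDITIONAL** (either eigenvalue may carry the `15`).
[cite: Ribet1983, Thm. 0 and Thm. 3] [cite: MoonenZarhin1999LowDim, §2 (2.4)] -/
theorem AbelianVariety.isDivisorGenerated_powSucc_of_sixtysevenfold_fifteenFiftyTwo (A : AbelianVariety ℂ)
    (φ : A ⟶ A) {d : ℕ} (hd : 0 < d) (hφ : φ ≫ φ = -(d • 𝟙 A)) (hE2 : Module.finrank ℚ A.endAlgebra = 2)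
    (hX : A.dim = 67)
    (h15 : eigenMultiplicity A φ (Complex.I * (Real.sqrt d : ℂ)) = 15 ∨
      eigenMultiplicity A φ (-(Complex.I * (Real.sqrt d : ℂ))) = 15)
    (N : ℕ) : IsDivisorGenerated (A.powSucc N) := by
  have hsum := eigenMultiplicity_add_eigenMultiplicity_neg_eq_dim A φ hd hφ
  rw [hX] at hsum
  rcases h15 with h | h
  · exact AbelianVariety.isDivisorGenerated_powSucc_of_ribetTypeFifteenFiftyTwo A φ hd hφ hE2 h (by omega) N
  · exact AbelianVariety.isDivisorGenerated_powSucc_of_ribetTypeFifteenFiftyTwo' A φ hd hφ hE2 (by omega) h N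

/-- **The Hodge conjecture for all powers of a 67-FOLD of signature `{15, 52}` — UNCONDITIONAL.**
[cite: Ribet1983, Thm. 3] [cite: Deligne2000, §1] -/
theorem hodgeConjectureFor_powSucc_of_sixtysevenfold_fifteenFiftyTwo (A : AbelianVariety ℂ)
    (φ : A ⟶ A) {d : ℕ} (hd : 0 < d) (hφ : φ ≫ φ = -(d • 𝟙 A)) (hE2 : Module.finrank ℚ A.endAlgebra = 2)
    (hX : A.dim = 67)
    (h15 : eigenMultiplicity A φ (Complex.I * (Real.sqrt d : ℂ)) = 15 ∨
      eigenMultiplicity A φ (-(Complex.I * (Real.sqrt d : ℂ))) = 15)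
    (N : ℕ) : HodgeConjectureFor (A.powSucc N).dim (A.powSucc N).X :=
  hodgeConjectureFor_of_isDivisorGenerated _
    (AbelianVariety.isDivisorGenerated_powSucc_of_sixtysevenfold_fifteenFiftyTwo A φ hd hφ hE2 hX h15 N)

/-- **Ribet 1983 Thm. 3 at `(n′, n″) = (16, 51)` — UNCONDITIONAL** (core `UnitarySixteenFiftyOne.eq_top_of_smul`).
[cite: Ribet1983, Thm. 0 and Thm. 3] [cite: Gordon1997, Thm. 6.3 (3) and Corollary] -/
theorem AbelianVariety.isDivisorGenerated_powSucc_of_ribetTypeSixteenFiftyOne (A : AbelianVariety ℂ) (φ : A ⟶ A)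
    {d : ℕ} (hd : 0 < d) (hφ : φ ≫ φ = -(d • 𝟙 A)) (hE2 : Module.finrank ℚ A.endAlgebra = 2)
    (h16 : eigenMultiplicity A φ (Complex.I * (Real.sqrt d : ℂ)) = 16)
    (h51 : eigenMultiplicity A φ (-(Complex.I * (Real.sqrt d : ℂ))) = 51) (N : ℕ) :
    IsDivisorGenerated (A.powSucc N) := by
  refine AbelianVariety.isDivisorGenerated_powSucc_of_ribetType_ofCoreSmul A φ hd hφ hE2 (by omega) (by omega) ?_ N
  intro W' _ _ _ 𝔊 ι P' Q' s hbr hirr hι hιι hP' hQ' hfinP' hfinQ' hadd hsmul hsymm hPQ hdefP hdefQ hadj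
  exact UnitarySixteenFiftyOne.eq_top_of_smul hbr hirr hι hιι hP' hQ' (by rw [hfinP', h16]) (by rw [hfinQ', h51]) hadd
    hsmul hsymm hPQ hdefP hdefQ hadj

/-- The mirror: `n_{i√d}(φ) = 51`, `n_{−i√d}(φ) = 16` (core `UnitarySixteenFiftyOne.eq_top_of_smul'`).
[cite: Ribet1983, Thm. 0 and Thm. 3] [cite: Gordon1997, Thm. 6.3 (3) and Corollary] -/
theorem AbelianVariety.isDivisorGenerated_powSucc_of_ribetTypeSixteenFiftyOne' (A : AbelianVariety ℂ) (φ : A ⟶ A)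
    {d : ℕ} (hd : 0 < d) (hφ : φ ≫ φ = -(d • 𝟙 A)) (hE2 : Module.finrank ℚ A.endAlgebra = 2)
    (h51 : eigenMultiplicity A φ (Complex.I * (Real.sqrt d : ℂ)) = 51)
    (h16 : eigenMultiplicity A φ (-(Complex.I * (Real.sqrt d : ℂ))) = 16) (N : ℕ) :
    IsDivisorGenerated (A.powSucc N) := by
  refine AbelianVariety.isDivisorGenerated_powSucc_of_ribetType_ofCoreSmul A φ hd hφ hE2 (by omega) (by omega) ?_ N
  intro W' _ _ _ 𝔊 ι P' Q' s hbr hirr hι hιι hP' hQ' hfinP' hfinQ' hadd hsmul hsymm hPQ hdefP hdefQ hadj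
  exact UnitarySixteenFiftyOne.eq_top_of_smul' hbr hirr hι hιι hP' hQ' (by rw [hfinP', h51]) (by rw [hfinQ', h16])
    hadd hsmul hsymm hPQ hdefP hdefQ hadj

/-- **The Hodge conjecture for all powers `A^{N+1}` of an abelian variety of Ribet type `(16, 51)` — UNCONDITIONAL.**
[cite: Ribet1983, Thm. 3] [cite: Deligne2000, §1] -/
theorem hodgeConjectureFor_powSucc_of_ribetTypeSixteenFiftyOne (A : AbelianVariety ℂ) (φ : A ⟶ A)
    {d : ℕ} (hd : 0 < d) (hφ : φ ≫ φ = -(d • 𝟙 A)) (hE2 : Module.finrank ℚ A.endAlgebra = 2)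
    (h16 : eigenMultiplicity A φ (Complex.I * (Real.sqrt d : ℂ)) = 16)
    (h51 : eigenMultiplicity A φ (-(Complex.I * (Real.sqrt d : ℂ))) = 51) (N : ℕ) :
    HodgeConjectureFor (A.powSucc N).dim (A.powSucc N).X :=
  hodgeConjectureFor_of_isDivisorGenerated _
    (AbelianVariety.isDivisorGenerated_powSucc_of_ribetTypeSixteenFiftyOne A φ hd hφ hE2 h16 h51 N)

/-- **67-FOLDS of signature `{16, 51}`: `B• = D•` on all powers — UNCONDITIONAL** (either eigenvalue may carry the `16`).
[cite: Ribet1983, Thm. 0 and Thm. 3] [cite: MoonenZarhin1999LowDim, §2 (2.4)] -/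
theorem AbelianVariety.isDivisorGenerated_powSucc_of_sixtysevenfold_sixteenFiftyOne (A : AbelianVariety ℂ)
    (φ : A ⟶ A) {d : ℕ} (hd : 0 < d) (hφ : φ ≫ φ = -(d • 𝟙 A)) (hE2 : Module.finrank ℚ A.endAlgebra = 2)
    (hX : A.dim = 67)
    (h16 : eigenMultiplicity A φ (Complex.I * (Real.sqrt d : ℂ)) = 16 ∨
      eigenMultiplicity A φ (-(Complex.I * (Real.sqrt d : ℂ))) = 16)
    (N : ℕ) : IsDivisorGenerated (A.powSucc N) := by
  have hsum := eigenMultiplicity_add_eigenMultiplicity_neg_eq_dim A φ hd hφ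
  rw [hX] at hsum
  rcases h16 with h | h
  · exact AbelianVariety.isDivisorGenerated_powSucc_of_ribetTypeSixteenFiftyOne A φ hd hφ hE2 h (by omega) N
  · exact AbelianVariety.isDivisorGenerated_powSucc_of_ribetTypeSixteenFiftyOne' A φ hd hφ hE2 (by omega) h N

/-- **The Hodge conjecture for all powers of a 67-FOLD of signature `{16, 51}` — UNCONDITIONAL.**
[cite: Ribet1983, Thm. 3] [cite: Deligne2000, §1] -/
theorem hodgeConjectureFor_powSucc_of_sixtysevenfold_sixteenFiftyOne (A : AbelianVariety ℂ)
    (φ : A ⟶ A) {d : ℕ} (hd : 0 < d) (hφ : φ ≫ φ = -(d • 𝟙 A)) (hE2 : Module.finrank ℚ A.endAlgebra = 2)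
    (hX : A.dim = 67)
    (h16 : eigenMultiplicity A φ (Complex.I * (Real.sqrt d : ℂ)) = 16 ∨
      eigenMultiplicity A φ (-(Complex.I * (Real.sqrt d : ℂ))) = 16)
    (N : ℕ) : HodgeConjectureFor (A.powSucc N).dim (A.powSucc N).X :=
  hodgeConjectureFor_of_isDivisorGenerated _
    (AbelianVariety.isDivisorGenerated_powSucc_of_sixtysevenfold_sixteenFiftyOne A φ hd hφ hE2 hX h16 N)

/-- **Ribet 1983 Thm. 3 at `(n′, n″) = (17, 50)` — UNCONDITIONAL** (core `UnitarySeventeenFifty.eq_top_of_smul`).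
[cite: Ribet1983, Thm. 0 and Thm. 3] [cite: Gordon1997, Thm. 6.3 (3) and Corollary] -/
theorem AbelianVariety.isDivisorGenerated_powSucc_of_ribetTypeSeventeenFifty (A : AbelianVariety ℂ) (φ : A ⟶ A)
    {d : ℕ} (hd : 0 < d) (hφ : φ ≫ φ = -(d • 𝟙 A)) (hE2 : Module.finrank ℚ A.endAlgebra = 2)
    (h17 : eigenMultiplicity A φ (Complex.I * (Real.sqrt d : ℂ)) = 17)
    (h50 : eigenMultiplicity A φ (-(Complex.I * (Real.sqrt d : ℂ))) = 50) (N : ℕ) :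
    IsDivisorGenerated (A.powSucc N) := by
  refine AbelianVariety.isDivisorGenerated_powSucc_of_ribetType_ofCoreSmul A φ hd hφ hE2 (by omega) (by omega) ?_ N
  intro W' _ _ _ 𝔊 ι P' Q' s hbr hirr hι hιι hP' hQ' hfinP' hfinQ' hadd hsmul hsymm hPQ hdefP hdefQ hadj
  exact UnitarySeventeenFifty.eq_top_of_smul hbr hirr hι hιι hP' hQ' (by rw [hfinP', h17]) (by rw [hfinQ', h50]) hadd
    hsmul hsymm hPQ hdefP hdefQ hadj

/-- The mirror: `n_{i√d}(φ) = 50`, `n_{−i√d}(φ) = 17` (core `UnitarySeventeenFifty.eq_top_of_smul'`).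
[cite: Ribet1983, Thm. 0 and Thm. 3] [cite: Gordon1997, Thm. 6.3 (3) and Corollary] -/
theorem AbelianVariety.isDivisorGenerated_powSucc_of_ribetTypeSeventeenFifty' (A : AbelianVariety ℂ) (φ : A ⟶ A)
    {d : ℕ} (hd : 0 < d) (hφ : φ ≫ φ = -(d • 𝟙 A)) (hE2 : Module.finrank ℚ A.endAlgebra = 2)
    (h50 : eigenMultiplicity A φ (Complex.I * (Real.sqrt d : ℂ)) = 50)
    (h17 : eigenMultiplicity A φ (-(Complex.I * (Real.sqrt d : ℂ))) = 17) (N : ℕ) :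
    IsDivisorGenerated (A.powSucc N) := by
  refine AbelianVariety.isDivisorGenerated_powSucc_of_ribetType_ofCoreSmul A φ hd hφ hE2 (by omega) (by omega) ?_ N
  intro W' _ _ _ 𝔊 ι P' Q' s hbr hirr hι hιι hP' hQ' hfinP' hfinQ' hadd hsmul hsymm hPQ hdefP hdefQ hadj
  exact UnitarySeventeenFifty.eq_top_of_smul' hbr hirr hι hιι hP' hQ' (by rw [hfinP', h50]) (by rw [hfinQ', h17])
    hadd hsmul hsymm hPQ hdefP hdefQ hadj

/-- **The Hodge conjecture for all powers `A^{N+1}` of an abelian variety of Ribet type `(17, 50)` — UNCONDITIONAL.**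
[cite: Ribet1983, Thm. 3] [cite: Deligne2000, §1] -/
theorem hodgeConjectureFor_powSucc_of_ribetTypeSeventeenFifty (A : AbelianVariety ℂ) (φ : A ⟶ A)
    {d : ℕ} (hd : 0 < d) (hφ : φ ≫ φ = -(d • 𝟙 A)) (hE2 : Module.finrank ℚ A.endAlgebra = 2)
    (h17 : eigenMultiplicity A φ (Complex.I * (Real.sqrt d : ℂ)) = 17)
    (h50 : eigenMultiplicity A φ (-(Complex.I * (Real.sqrt d : ℂ))) = 50) (N : ℕ) :
    HodgeConjectureFor (A.powSucc N).dim (A.powSucc N).X :=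
  hodgeConjectureFor_of_isDivisorGenerated _
    (AbelianVariety.isDivisorGenerated_powSucc_of_ribetTypeSeventeenFifty A φ hd hφ hE2 h17 h50 N)

/-- **67-FOLDS of signature `{17, 50}`: `B• = D•` on all powers — UNCONDITIONAL** (either eigenvalue may carry the `17`).
[cite: Ribet1983, Thm. 0 and Thm. 3] [cite: MoonenZarhin1999LowDim, §2 (2.4)] -/
theorem AbelianVariety.isDivisorGenerated_powSucc_of_sixtysevenfold_seventeenFifty (A : AbelianVariety ℂ)
    (φ : A ⟶ A) {d : ℕ} (hd : 0 < d) (hφ : φ ≫ φ = -(d • 𝟙 A)) (hE2 : Module.finrank ℚ A.endAlgebra = 2)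
    (hX : A.dim = 67)
    (h17 : eigenMultiplicity A φ (Complex.I * (Real.sqrt d : ℂ)) = 17 ∨
      eigenMultiplicity A φ (-(Complex.I * (Real.sqrt d : ℂ))) = 17)
    (N : ℕ) : IsDivisorGenerated (A.powSucc N) := by
  have hsum := eigenMultiplicity_add_eigenMultiplicity_neg_eq_dim A φ hd hφ
  rw [hX] at hsum
  rcases h17 with h | h
  · exact AbelianVariety.isDivisorGenerated_powSucc_of_ribetTypeSeventeenFifty A φ hd hφ hE2 h (by omega) N
  · exact AbelianVariety.isDivisorGenerated_powSucc_of_ribetTypeSeventeenFifty' A φ hd hφ hE2 (by omega) h N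

/-- **The Hodge conjecture for all powers of a 67-FOLD of signature `{17, 50}` — UNCONDITIONAL.**
[cite: Ribet1983, Thm. 3] [cite: Deligne2000, §1] -/
theorem hodgeConjectureFor_powSucc_of_sixtysevenfold_seventeenFifty (A : AbelianVariety ℂ)
    (φ : A ⟶ A) {d : ℕ} (hd : 0 < d) (hφ : φ ≫ φ = -(d • 𝟙 A)) (hE2 : Module.finrank ℚ A.endAlgebra = 2)
    (hX : A.dim = 67)
    (h17 : eigenMultiplicity A φ (Complex.I * (Real.sqrt d : ℂ)) = 17 ∨
      eigenMultiplicity A φ (-(Complex.I * (Real.sqrt d : ℂ))) = 17)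
    (N : ℕ) : HodgeConjectureFor (A.powSucc N).dim (A.powSucc N).X :=
  hodgeConjectureFor_of_isDivisorGenerated _
    (AbelianVariety.isDivisorGenerated_powSucc_of_sixtysevenfold_seventeenFifty A φ hd hφ hE2 hX h17 N)

/-- **Ribet 1983 Thm. 3 at `(n′, n″) = (18, 49)` — UNCONDITIONAL** (core `UnitaryEighteenFortyNine.eq_top_of_smul`).
[cite: Ribet1983, Thm. 0 and Thm. 3] [cite: Gordon1997, Thm. 6.3 (3) and Corollary] -/
theorem AbelianVariety.isDivisorGenerated_powSucc_of_ribetTypeEighteenFortyNine (A : AbelianVariety ℂ) (φ : A ⟶ A)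
    {d : ℕ} (hd : 0 < d) (hφ : φ ≫ φ = -(d • 𝟙 A)) (hE2 : Module.finrank ℚ A.endAlgebra = 2)
    (h18 : eigenMultiplicity A φ (Complex.I * (Real.sqrt d : ℂ)) = 18)
    (h49 : eigenMultiplicity A φ (-(Complex.I * (Real.sqrt d : ℂ))) = 49) (N : ℕ) :
    IsDivisorGenerated (A.powSucc N) := by
  refine AbelianVariety.isDivisorGenerated_powSucc_of_ribetType_ofCoreSmul A φ hd hφ hE2 (by omega) (by omega) ?_ N
  intro W' _ _ _ 𝔊 ι P' Q' s hbr hirr hι hιι hP' hQ' hfinP' hfinQ' hadd hsmul hsymm hPQ hdefP hdefQ hadj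
  exact UnitaryEighteenFortyNine.eq_top_of_smul hbr hirr hι hιι hP' hQ' (by rw [hfinP', h18]) (by rw [hfinQ', h49]) hadd
    hsmul hsymm hPQ hdefP hdefQ hadj

/-- The mirror: `n_{i√d}(φ) = 49`, `n_{−i√d}(φ) = 18` (core `UnitaryEighteenFortyNine.eq_top_of_smul'`).
[cite: Ribet1983, Thm. 0 and Thm. 3] [cite: Gordon1997, Thm. 6.3 (3) and Corollary] -/
theorem AbelianVariety.isDivisorGenerated_powSucc_of_ribetTypeEighteenFortyNine' (A : AbelianVariety ℂ) (φ : A ⟶ A)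
    {d : ℕ} (hd : 0 < d) (hφ : φ ≫ φ = -(d • 𝟙 A)) (hE2 : Module.finrank ℚ A.endAlgebra = 2)
    (h49 : eigenMultiplicity A φ (Complex.I * (Real.sqrt d : ℂ)) = 49)
    (h18 : eigenMultiplicity A φ (-(Complex.I * (Real.sqrt d : ℂ))) = 18) (N : ℕ) :
    IsDivisorGenerated (A.powSucc N) := by
  refine AbelianVariety.isDivisorGenerated_powSucc_of_ribetType_ofCoreSmul A φ hd hφ hE2 (by omega) (by omega) ?_ N
  intro W' _ _ _ 𝔊 ι P' Q' s hbr hirr hι hιι hP' hQ' hfinP' hfinQ' hadd hsmul hsymm hPQ hdefP hdefQ hadj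
  exact UnitaryEighteenFortyNine.eq_top_of_smul' hbr hirr hι hιι hP' hQ' (by rw [hfinP', h49]) (by rw [hfinQ', h18])
    hadd hsmul hsymm hPQ hdefP hdefQ hadj

/-- **The Hodge conjecture for all powers `A^{N+1}` of an abelian variety of Ribet type `(18, 49)` — UNCONDITIONAL.**
[cite: Ribet1983, Thm. 3] [cite: Deligne2000, §1] -/
theorem hodgeConjectureFor_powSucc_of_ribetTypeEighteenFortyNine (A : AbelianVariety ℂ) (φ : A ⟶ A)
    {d : ℕ} (hd : 0 < d) (hφ : φ ≫ φ = -(d • 𝟙 A)) (hE2 : Module.finrank ℚ A.endAlgebra = 2)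
    (h18 : eigenMultiplicity A φ (Complex.I * (Real.sqrt d : ℂ)) = 18)
    (h49 : eigenMultiplicity A φ (-(Complex.I * (Real.sqrt d : ℂ))) = 49) (N : ℕ) :
    HodgeConjectureFor (A.powSucc N).dim (A.powSucc N).X :=
  hodgeConjectureFor_of_isDivisorGenerated _
    (AbelianVariety.isDivisorGenerated_powSucc_of_ribetTypeEighteenFortyNine A φ hd hφ hE2 h18 h49 N)

/-- **67-FOLDS of signature `{18, 49}`: `B• = D•` on all powers — UNCONDITIONAL** (either eigenvalue may carry the `18`).
[cite: Ribet1983, Thm. 0 and Thm. 3] [cite: MoonenZarhin1999LowDim, §2 (2.4)] -/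
theorem AbelianVariety.isDivisorGenerated_powSucc_of_sixtysevenfold_eighteenFortyNine (A : AbelianVariety ℂ)
    (φ : A ⟶ A) {d : ℕ} (hd : 0 < d) (hφ : φ ≫ φ = -(d • 𝟙 A)) (hE2 : Module.finrank ℚ A.endAlgebra = 2)
    (hX : A.dim = 67)
    (h18 : eigenMultiplicity A φ (Complex.I * (Real.sqrt d : ℂ)) = 18 ∨
      eigenMultiplicity A φ (-(Complex.I * (Real.sqrt d : ℂ))) = 18)
    (N : ℕ) : IsDivisorGenerated (A.powSucc N) := by
  have hsum := eigenMultiplicity_add_eigenMultiplicity_neg_eq_dim A φ hd hφ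
  rw [hX] at hsum
  rcases h18 with h | h
  · exact AbelianVariety.isDivisorGenerated_powSucc_of_ribetTypeEighteenFortyNine A φ hd hφ hE2 h (by omega) N
  · exact AbelianVariety.isDivisorGenerated_powSucc_of_ribetTypeEighteenFortyNine' A φ hd hφ hE2 (by omega) h N

/-- **The Hodge conjecture for all powers of a 67-FOLD of signature `{18, 49}` — UNCONDITIONAL.**
[cite: Ribet1983, Thm. 3] [cite: Deligne2000, §1] -/
theorem hodgeConjectureFor_powSucc_of_sixtysevenfold_eighteenFortyNine (A : AbelianVariety ℂ)
    (φ : A ⟶ A) {d : ℕ} (hd : 0 < d) (hφ : φ ≫ φ = -(d • 𝟙 A)) (hE2 : Module.finrank ℚ A.endAlgebra = 2)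
    (hX : A.dim = 67)
    (h18 : eigenMultiplicity A φ (Complex.I * (Real.sqrt d : ℂ)) = 18 ∨
      eigenMultiplicity A φ (-(Complex.I * (Real.sqrt d : ℂ))) = 18)
    (N : ℕ) : HodgeConjectureFor (A.powSucc N).dim (A.powSucc N).X :=
  hodgeConjectureFor_of_isDivisorGenerated _
    (AbelianVariety.isDivisorGenerated_powSucc_of_sixtysevenfold_eighteenFortyNine A φ hd hφ hE2 hX h18 N)

/-- **Ribet 1983 Thm. 3 at `(n′, n″) = (19, 48)` — UNCONDITIONAL** (core `UnitaryNineteenFortyEight.eq_top_of_smul`).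
[cite: Ribet1983, Thm. 0 and Thm. 3] [cite: Gordon1997, Thm. 6.3 (3) and Corollary] -/
theorem AbelianVariety.isDivisorGenerated_powSucc_of_ribetTypeNineteenFortyEight (A : AbelianVariety ℂ) (φ : A ⟶ A)
    {d : ℕ} (hd : 0 < d) (hφ : φ ≫ φ = -(d • 𝟙 A)) (hE2 : Module.finrank ℚ A.endAlgebra = 2)
    (h19 : eigenMultiplicity A φ (Complex.I * (Real.sqrt d : ℂ)) = 19)
    (h48 : eigenMultiplicity A φ (-(Complex.I * (Real.sqrt d : ℂ))) = 48) (N : ℕ) :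
    IsDivisorGenerated (A.powSucc N) := by
  refine AbelianVariety.isDivisorGenerated_powSucc_of_ribetType_ofCoreSmul A φ hd hφ hE2 (by omega) (by omega) ?_ N
  intro W' _ _ _ 𝔊 ι P' Q' s hbr hirr hι hιι hP' hQ' hfinP' hfinQ' hadd hsmul hsymm hPQ hdefP hdefQ hadj
  exact UnitaryNineteenFortyEight.eq_top_of_smul hbr hirr hι hιι hP' hQ' (by rw [hfinP', h19]) (by rw [hfinQ', h48]) hadd
    hsmul hsymm hPQ hdefP hdefQ hadj

/-- The mirror: `n_{i√d}(φ) = 48`, `n_{−i√d}(φ) = 19` (core `UnitaryNineteenFortyEight.eq_top_of_smul'`).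
[cite: Ribet1983, Thm. 0 and Thm. 3] [cite: Gordon1997, Thm. 6.3 (3) and Corollary] -/
theorem AbelianVariety.isDivisorGenerated_powSucc_of_ribetTypeNineteenFortyEight' (A : AbelianVariety ℂ) (φ : A ⟶ A)
    {d : ℕ} (hd : 0 < d) (hφ : φ ≫ φ = -(d • 𝟙 A)) (hE2 : Module.finrank ℚ A.endAlgebra = 2)
    (h48 : eigenMultiplicity A φ (Complex.I * (Real.sqrt d : ℂ)) = 48)
    (h19 : eigenMultiplicity A φ (-(Complex.I * (Real.sqrt d : ℂ))) = 19) (N : ℕ) :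
    IsDivisorGenerated (A.powSucc N) := by
  refine AbelianVariety.isDivisorGenerated_powSucc_of_ribetType_ofCoreSmul A φ hd hφ hE2 (by omega) (by omega) ?_ N
  intro W' _ _ _ 𝔊 ι P' Q' s hbr hirr hι hιι hP' hQ' hfinP' hfinQ' hadd hsmul hsymm hPQ hdefP hdefQ hadj
  exact UnitaryNineteenFortyEight.eq_top_of_smul' hbr hirr hι hιι hP' hQ' (by rw [hfinP', h48]) (by rw [hfinQ', h19])
    hadd hsmul hsymm hPQ hdefP hdefQ hadj

/-- **The Hodge conjecture for all powers `A^{N+1}` of an abelian variety of Ribet type `(19, 48)` — UNCONDITIONAL.**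
[cite: Ribet1983, Thm. 3] [cite: Deligne2000, §1] -/
theorem hodgeConjectureFor_powSucc_of_ribetTypeNineteenFortyEight (A : AbelianVariety ℂ) (φ : A ⟶ A)
    {d : ℕ} (hd : 0 < d) (hφ : φ ≫ φ = -(d • 𝟙 A)) (hE2 : Module.finrank ℚ A.endAlgebra = 2)
    (h19 : eigenMultiplicity A φ (Complex.I * (Real.sqrt d : ℂ)) = 19)
    (h48 : eigenMultiplicity A φ (-(Complex.I * (Real.sqrt d : ℂ))) = 48) (N : ℕ) :
    HodgeConjectureFor (A.powSucc N).dim (A.powSucc N).X :=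
  hodgeConjectureFor_of_isDivisorGenerated _
    (AbelianVariety.isDivisorGenerated_powSucc_of_ribetTypeNineteenFortyEight A φ hd hφ hE2 h19 h48 N)

/-- **67-FOLDS of signature `{19, 48}`: `B• = D•` on all powers — UNCONDITIONAL** (either eigenvalue may carry the `19`).
[cite: Ribet1983, Thm. 0 and Thm. 3] [cite: MoonenZarhin1999LowDim, §2 (2.4)] -/
theorem AbelianVariety.isDivisorGenerated_powSucc_of_sixtysevenfold_nineteenFortyEight (A : AbelianVariety ℂ)
    (φ : A ⟶ A) {d : ℕ} (hd : 0 < d) (hφ : φ ≫ φ = -(d • 𝟙 A)) (hE2 : Module.finrank ℚ A.endAlgebra = 2)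
    (hX : A.dim = 67)
    (h19 : eigenMultiplicity A φ (Complex.I * (Real.sqrt d : ℂ)) = 19 ∨
      eigenMultiplicity A φ (-(Complex.I * (Real.sqrt d : ℂ))) = 19)
    (N : ℕ) : IsDivisorGenerated (A.powSucc N) := by
  have hsum := eigenMultiplicity_add_eigenMultiplicity_neg_eq_dim A φ hd hφ
  rw [hX] at hsum
  rcases h19 with h | h
  · exact AbelianVariety.isDivisorGenerated_powSucc_of_ribetTypeNineteenFortyEight A φ hd hφ hE2 h (by omega) N
  · exact AbelianVariety.isDivisorGenerated_powSucc_of_ribetTypeNineteenFortyEight' A φ hd hφ hE2 (by omega) h N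

/-- **The Hodge conjecture for all powers of a 67-FOLD of signature `{19, 48}` — UNCONDITIONAL.**
[cite: Ribet1983, Thm. 3] [cite: Deligne2000, §1] -/
theorem hodgeConjectureFor_powSucc_of_sixtysevenfold_nineteenFortyEight (A : AbelianVariety ℂ)
    (φ : A ⟶ A) {d : ℕ} (hd : 0 < d) (hφ : φ ≫ φ = -(d • 𝟙 A)) (hE2 : Module.finrank ℚ A.endAlgebra = 2)
    (hX : A.dim = 67)
    (h19 : eigenMultiplicity A φ (Complex.I * (Real.sqrt d : ℂ)) = 19 ∨
      eigenMultiplicity A φ (-(Complex.I * (Real.sqrt d : ℂ))) = 19)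
    (N : ℕ) : HodgeConjectureFor (A.powSucc N).dim (A.powSucc N).X :=
  hodgeConjectureFor_of_isDivisorGenerated _
    (AbelianVariety.isDivisorGenerated_powSucc_of_sixtysevenfold_nineteenFortyEight A φ hd hφ hE2 hX h19 N)

/-- **Ribet 1983 Thm. 3 at `(n′, n″) = (21, 46)` — UNCONDITIONAL** (core `UnitaryTwentyOneFortySix.eq_top_of_smul`).
[cite: Ribet1983, Thm. 0 and Thm. 3] [cite: Gordon1997, Thm. 6.3 (3) and Corollary] -/
theorem AbelianVariety.isDivisorGenerated_powSucc_of_ribetTypeTwentyOneFortySix (A : AbelianVariety ℂ) (φ : A ⟶ A)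
    {d : ℕ} (hd : 0 < d) (hφ : φ ≫ φ = -(d • 𝟙 A)) (hE2 : Module.finrank ℚ A.endAlgebra = 2)
    (h21 : eigenMultiplicity A φ (Complex.I * (Real.sqrt d : ℂ)) = 21)
    (h46 : eigenMultiplicity A φ (-(Complex.I * (Real.sqrt d : ℂ))) = 46) (N : ℕ) :
    IsDivisorGenerated (A.powSucc N) := by
  refine AbelianVariety.isDivisorGenerated_powSucc_of_ribetType_ofCoreSmul A φ hd hφ hE2 (by omega) (by omega) ?_ N
  intro W' _ _ _ 𝔊 ι P' Q' s hbr hirr hι hιι hP' hQ' hfinP' hfinQ' hadd hsmul hsymm hPQ hdefP hdefQ hadj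
  exact UnitaryTwentyOneFortySix.eq_top_of_smul hbr hirr hι hιι hP' hQ' (by rw [hfinP', h21]) (by rw [hfinQ', h46]) hadd
    hsmul hsymm hPQ hdefP hdefQ hadj

/-- The mirror: `n_{i√d}(φ) = 46`, `n_{−i√d}(φ) = 21` (core `UnitaryTwentyOneFortySix.eq_top_of_smul'`).
[cite: Ribet1983, Thm. 0 and Thm. 3] [cite: Gordon1997, Thm. 6.3 (3) and Corollary] -/
theorem AbelianVariety.isDivisorGenerated_powSucc_of_ribetTypeTwentyOneFortySix' (A : AbelianVariety ℂ) (φ : A ⟶ A)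
    {d : ℕ} (hd : 0 < d) (hφ : φ ≫ φ = -(d • 𝟙 A)) (hE2 : Module.finrank ℚ A.endAlgebra = 2)
    (h46 : eigenMultiplicity A φ (Complex.I * (Real.sqrt d : ℂ)) = 46)
    (h21 : eigenMultiplicity A φ (-(Complex.I * (Real.sqrt d : ℂ))) = 21) (N : ℕ) :
    IsDivisorGenerated (A.powSucc N) := by
  refine AbelianVariety.isDivisorGenerated_powSucc_of_ribetType_ofCoreSmul A φ hd hφ hE2 (by omega) (by omega) ?_ N
  intro W' _ _ _ 𝔊 ι P' Q' s hbr hirr hι hιι hP' hQ' hfinP' hfinQ' hadd hsmul hsymm hPQ hdefP hdefQ hadj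
  exact UnitaryTwentyOneFortySix.eq_top_of_smul' hbr hirr hι hιι hP' hQ' (by rw [hfinP', h46]) (by rw [hfinQ', h21])
    hadd hsmul hsymm hPQ hdefP hdefQ hadj

/-- **The Hodge conjecture for all powers `A^{N+1}` of an abelian variety of Ribet type `(21, 46)` — UNCONDITIONAL.**
[cite: Ribet1983, Thm. 3] [cite: Deligne2000, §1] -/
theorem hodgeConjectureFor_powSucc_of_ribetTypeTwentyOneFortySix (A : AbelianVariety ℂ) (φ : A ⟶ A)
    {d : ℕ} (hd : 0 < d) (hφ : φ ≫ φ = -(d • 𝟙 A)) (hE2 : Module.finrank ℚ A.endAlgebra = 2)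
    (h21 : eigenMultiplicity A φ (Complex.I * (Real.sqrt d : ℂ)) = 21)
    (h46 : eigenMultiplicity A φ (-(Complex.I * (Real.sqrt d : ℂ))) = 46) (N : ℕ) :
    HodgeConjectureFor (A.powSucc N).dim (A.powSucc N).X :=
  hodgeConjectureFor_of_isDivisorGenerated _
    (AbelianVariety.isDivisorGenerated_powSucc_of_ribetTypeTwentyOneFortySix A φ hd hφ hE2 h21 h46 N)

/-- **67-FOLDS of signature `{21, 46}`: `B• = D•` on all powers — UNCONDITIONAL** (either eigenvalue may carry the `21`).
[cite: Ribet1983, Thm. 0 and Thm. 3] [cite: MoonenZarhin1999LowDim, §2 (2.4)] -/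
theorem AbelianVariety.isDivisorGenerated_powSucc_of_sixtysevenfold_twentyOneFortySix (A : AbelianVariety ℂ)
    (φ : A ⟶ A) {d : ℕ} (hd : 0 < d) (hφ : φ ≫ φ = -(d • 𝟙 A)) (hE2 : Module.finrank ℚ A.endAlgebra = 2)
    (hX : A.dim = 67)
    (h21 : eigenMultiplicity A φ (Complex.I * (Real.sqrt d : ℂ)) = 21 ∨
      eigenMultiplicity A φ (-(Complex.I * (Real.sqrt d : ℂ))) = 21)
    (N : ℕ) : IsDivisorGenerated (A.powSucc N) := by
  have hsum := eigenMultiplicity_add_eigenMultiplicity_neg_eq_dim A φ hd hφ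
  rw [hX] at hsum
  rcases h21 with h | h
  · exact AbelianVariety.isDivisorGenerated_powSucc_of_ribetTypeTwentyOneFortySix A φ hd hφ hE2 h (by omega) N
  · exact AbelianVariety.isDivisorGenerated_powSucc_of_ribetTypeTwentyOneFortySix' A φ hd hφ hE2 (by omega) h N

/-- **The Hodge conjecture for all powers of a 67-FOLD of signature `{21, 46}` — UNCONDITIONAL.**
[cite: Ribet1983, Thm. 3] [cite: Deligne2000, §1] -/
theorem hodgeConjectureFor_powSucc_of_sixtysevenfold_twentyOneFortySix (A : AbelianVariety ℂ)
    (φ : A ⟶ A) {d : ℕ} (hd : 0 < d) (hφ : φ ≫ φ = -(d • 𝟙 A)) (hE2 : Module.finrank ℚ A.endAlgebra = 2)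
    (hX : A.dim = 67)
    (h21 : eigenMultiplicity A φ (Complex.I * (Real.sqrt d : ℂ)) = 21 ∨
      eigenMultiplicity A φ (-(Complex.I * (Real.sqrt d : ℂ))) = 21)
    (N : ℕ) : HodgeConjectureFor (A.powSucc N).dim (A.powSucc N).X :=
  hodgeConjectureFor_of_isDivisorGenerated _
    (AbelianVariety.isDivisorGenerated_powSucc_of_sixtysevenfold_twentyOneFortySix A φ hd hφ hE2 hX h21 N)

/-- **Ribet 1983 Thm. 3 at `(n′, n″) = (22, 45)` — UNCONDITIONAL** (core `UnitaryTwentyTwoFortyFive.eq_top_of_smul`).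
[cite: Ribet1983, Thm. 0 and Thm. 3] [cite: Gordon1997, Thm. 6.3 (3) and Corollary] -/
theorem AbelianVariety.isDivisorGenerated_powSucc_of_ribetTypeTwentyTwoFortyFive (A : AbelianVariety ℂ) (φ : A ⟶ A)
    {d : ℕ} (hd : 0 < d) (hφ : φ ≫ φ = -(d • 𝟙 A)) (hE2 : Module.finrank ℚ A.endAlgebra = 2)
    (h22 : eigenMultiplicity A φ (Complex.I * (Real.sqrt d : ℂ)) = 22)
    (h45 : eigenMultiplicity A φ (-(Complex.I * (Real.sqrt d : ℂ))) = 45) (N : ℕ) :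
    IsDivisorGenerated (A.powSucc N) := by
  refine AbelianVariety.isDivisorGenerated_powSucc_of_ribetType_ofCoreSmul A φ hd hφ hE2 (by omega) (by omega) ?_ N
  intro W' _ _ _ 𝔊 ι P' Q' s hbr hirr hι hιι hP' hQ' hfinP' hfinQ' hadd hsmul hsymm hPQ hdefP hdefQ hadj
  exact UnitaryTwentyTwoFortyFive.eq_top_of_smul hbr hirr hι hιι hP' hQ' (by rw [hfinP', h22]) (by rw [hfinQ', h45]) hadd
    hsmul hsymm hPQ hdefP hdefQ hadj

/-- The mirror: `n_{i√d}(φ) = 45`, `n_{−i√d}(φ) = 22` (core `UnitaryTwentyTwoFortyFive.eq_top_of_smul'`).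
[cite: Ribet1983, Thm. 0 and Thm. 3] [cite: Gordon1997, Thm. 6.3 (3) and Corollary] -/
theorem AbelianVariety.isDivisorGenerated_powSucc_of_ribetTypeTwentyTwoFortyFive' (A : AbelianVariety ℂ) (φ : A ⟶ A)
    {d : ℕ} (hd : 0 < d) (hφ : φ ≫ φ = -(d • 𝟙 A)) (hE2 : Module.finrank ℚ A.endAlgebra = 2)
    (h45 : eigenMultiplicity A φ (Complex.I * (Real.sqrt d : ℂ)) = 45)
    (h22 : eigenMultiplicity A φ (-(Complex.I * (Real.sqrt d : ℂ))) = 22) (N : ℕ) :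
    IsDivisorGenerated (A.powSucc N) := by
  refine AbelianVariety.isDivisorGenerated_powSucc_of_ribetType_ofCoreSmul A φ hd hφ hE2 (by omega) (by omega) ?_ N
  intro W' _ _ _ 𝔊 ι P' Q' s hbr hirr hι hιι hP' hQ' hfinP' hfinQ' hadd hsmul hsymm hPQ hdefP hdefQ hadj
  exact UnitaryTwentyTwoFortyFive.eq_top_of_smul' hbr hirr hι hιι hP' hQ' (by rw [hfinP', h45]) (by rw [hfinQ', h22])
    hadd hsmul hsymm hPQ hdefP hdefQ hadj

/-- **The Hodge conjecture for all powers `A^{N+1}` of an abelian variety of Ribet type `(22, 45)` — UNCONDITIONAL.**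
[cite: Ribet1983, Thm. 3] [cite: Deligne2000, §1] -/
theorem hodgeConjectureFor_powSucc_of_ribetTypeTwentyTwoFortyFive (A : AbelianVariety ℂ) (φ : A ⟶ A)
    {d : ℕ} (hd : 0 < d) (hφ : φ ≫ φ = -(d • 𝟙 A)) (hE2 : Module.finrank ℚ A.endAlgebra = 2)
    (h22 : eigenMultiplicity A φ (Complex.I * (Real.sqrt d : ℂ)) = 22)
    (h45 : eigenMultiplicity A φ (-(Complex.I * (Real.sqrt d : ℂ))) = 45) (N : ℕ) :
    HodgeConjectureFor (A.powSucc N).dim (A.powSucc N).X :=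
  hodgeConjectureFor_of_isDivisorGenerated _
    (AbelianVariety.isDivisorGenerated_powSucc_of_ribetTypeTwentyTwoFortyFive A φ hd hφ hE2 h22 h45 N)

/-- **67-FOLDS of signature `{22, 45}`: `B• = D•` on all powers — UNCONDITIONAL** (either eigenvalue may carry the `22`).
[cite: Ribet1983, Thm. 0 and Thm. 3] [cite: MoonenZarhin1999LowDim, §2 (2.4)] -/
theorem AbelianVariety.isDivisorGenerated_powSucc_of_sixtysevenfold_twentyTwoFortyFive (A : AbelianVariety ℂ)
    (φ : A ⟶ A) {d : ℕ} (hd : 0 < d) (hφ : φ ≫ φ = -(d • 𝟙 A)) (hE2 : Module.finrank ℚ A.endAlgebra = 2)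
    (hX : A.dim = 67)
    (h22 : eigenMultiplicity A φ (Complex.I * (Real.sqrt d : ℂ)) = 22 ∨
      eigenMultiplicity A φ (-(Complex.I * (Real.sqrt d : ℂ))) = 22)
    (N : ℕ) : IsDivisorGenerated (A.powSucc N) := by
  have hsum := eigenMultiplicity_add_eigenMultiplicity_neg_eq_dim A φ hd hφ
  rw [hX] at hsum
  rcases h22 with h | h
  · exact AbelianVariety.isDivisorGenerated_powSucc_of_ribetTypeTwentyTwoFortyFive A φ hd hφ hE2 h (by omega) N
  · exact AbelianVariety.isDivisorGenerated_powSucc_of_ribetTypeTwentyTwoFortyFive' A φ hd hφ hE2 (by omega) h N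

/-- **The Hodge conjecture for all powers of a 67-FOLD of signature `{22, 45}` — UNCONDITIONAL.**
[cite: Ribet1983, Thm. 3] [cite: Deligne2000, §1] -/
theorem hodgeConjectureFor_powSucc_of_sixtysevenfold_twentyTwoFortyFive (A : AbelianVariety ℂ)
    (φ : A ⟶ A) {d : ℕ} (hd : 0 < d) (hφ : φ ≫ φ = -(d • 𝟙 A)) (hE2 : Module.finrank ℚ A.endAlgebra = 2)
    (hX : A.dim = 67)
    (h22 : eigenMultiplicity A φ (Complex.I * (Real.sqrt d : ℂ)) = 22 ∨
      eigenMultiplicity A φ (-(Complex.I * (Real.sqrt d : ℂ))) = 22)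
    (N : ℕ) : HodgeConjectureFor (A.powSucc N).dim (A.powSucc N).X :=
  hodgeConjectureFor_of_isDivisorGenerated _
    (AbelianVariety.isDivisorGenerated_powSucc_of_sixtysevenfold_twentyTwoFortyFive A φ hd hφ hE2 hX h22 N)

/-- **Ribet 1983 Thm. 3 at `(n′, n″) = (23, 44)` — UNCONDITIONAL** (core `UnitaryTwentyThreeFortyFour.eq_top_of_smul`).
[cite: Ribet1983, Thm. 0 and Thm. 3] [cite: Gordon1997, Thm. 6.3 (3) and Corollary] -/
theorem AbelianVariety.isDivisorGenerated_powSucc_of_ribetTypeTwentyThreeFortyFour (A : AbelianVariety ℂ) (φ : A ⟶ A)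
    {d : ℕ} (hd : 0 < d) (hφ : φ ≫ φ = -(d • 𝟙 A)) (hE2 : Module.finrank ℚ A.endAlgebra = 2)
    (h23 : eigenMultiplicity A φ (Complex.I * (Real.sqrt d : ℂ)) = 23)
    (h44 : eigenMultiplicity A φ (-(Complex.I * (Real.sqrt d : ℂ))) = 44) (N : ℕ) :
    IsDivisorGenerated (A.powSucc N) := by
  refine AbelianVariety.isDivisorGenerated_powSucc_of_ribetType_ofCoreSmul A φ hd hφ hE2 (by omega) (by omega) ?_ N
  intro W' _ _ _ 𝔊 ι P' Q' s hbr hirr hι hιι hP' hQ' hfinP' hfinQ' hadd hsmul hsymm hPQ hdefP hdefQ hadj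
  exact UnitaryTwentyThreeFortyFour.eq_top_of_smul hbr hirr hι hιι hP' hQ' (by rw [hfinP', h23]) (by rw [hfinQ', h44]) hadd
    hsmul hsymm hPQ hdefP hdefQ hadj

/-- The mirror: `n_{i√d}(φ) = 44`, `n_{−i√d}(φ) = 23` (core `UnitaryTwentyThreeFortyFour.eq_top_of_smul'`).
[cite: Ribet1983, Thm. 0 and Thm. 3] [cite: Gordon1997, Thm. 6.3 (3) and Corollary] -/
theorem AbelianVariety.isDivisorGenerated_powSucc_of_ribetTypeTwentyThreeFortyFour' (A : AbelianVariety ℂ) (φ : A ⟶ A)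
    {d : ℕ} (hd : 0 < d) (hφ : φ ≫ φ = -(d • 𝟙 A)) (hE2 : Module.finrank ℚ A.endAlgebra = 2)
    (h44 : eigenMultiplicity A φ (Complex.I * (Real.sqrt d : ℂ)) = 44)
    (h23 : eigenMultiplicity A φ (-(Complex.I * (Real.sqrt d : ℂ))) = 23) (N : ℕ) :
    IsDivisorGenerated (A.powSucc N) := by
  refine AbelianVariety.isDivisorGenerated_powSucc_of_ribetType_ofCoreSmul A φ hd hφ hE2 (by omega) (by omega) ?_ N
  intro W' _ _ _ 𝔊 ι P' Q' s hbr hirr hι hιι hP' hQ' hfinP' hfinQ' hadd hsmul hsymm hPQ hdefP hdefQ hadj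
  exact UnitaryTwentyThreeFortyFour.eq_top_of_smul' hbr hirr hι hιι hP' hQ' (by rw [hfinP', h44]) (by rw [hfinQ', h23])
    hadd hsmul hsymm hPQ hdefP hdefQ hadj

/-- **The Hodge conjecture for all powers `A^{N+1}` of an abelian variety of Ribet type `(23, 44)` — UNCONDITIONAL.**
[cite: Ribet1983, Thm. 3] [cite: Deligne2000, §1] -/
theorem hodgeConjectureFor_powSucc_of_ribetTypeTwentyThreeFortyFour (A : AbelianVariety ℂ) (φ : A ⟶ A)
    {d : ℕ} (hd : 0 < d) (hφ : φ ≫ φ = -(d • 𝟙 A)) (hE2 : Module.finrank ℚ A.endAlgebra = 2)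
    (h23 : eigenMultiplicity A φ (Complex.I * (Real.sqrt d : ℂ)) = 23)
    (h44 : eigenMultiplicity A φ (-(Complex.I * (Real.sqrt d : ℂ))) = 44) (N : ℕ) :
    HodgeConjectureFor (A.powSucc N).dim (A.powSucc N).X :=
  hodgeConjectureFor_of_isDivisorGenerated _
    (AbelianVariety.isDivisorGenerated_powSucc_of_ribetTypeTwentyThreeFortyFour A φ hd hφ hE2 h23 h44 N)

/-- **67-FOLDS of signature `{23, 44}`: `B• = D•` on all powers — UNCONDITIONAL** (either eigenvalue may carry the `23`).
[cite: Ribet1983, Thm. 0 and Thm. 3] [cite: MoonenZarhin1999LowDim, §2 (2.4)] -/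
theorem AbelianVariety.isDivisorGenerated_powSucc_of_sixtysevenfold_twentyThreeFortyFour (A : AbelianVariety ℂ)
    (φ : A ⟶ A) {d : ℕ} (hd : 0 < d) (hφ : φ ≫ φ = -(d • 𝟙 A)) (hE2 : Module.finrank ℚ A.endAlgebra = 2)
    (hX : A.dim = 67)
    (h23 : eigenMultiplicity A φ (Complex.I * (Real.sqrt d : ℂ)) = 23 ∨
      eigenMultiplicity A φ (-(Complex.I * (Real.sqrt d : ℂ))) = 23)
    (N : ℕ) : IsDivisorGenerated (A.powSucc N) := by
  have hsum := eigenMultiplicity_add_eigenMultiplicity_neg_eq_dim A φ hd hφ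
  rw [hX] at hsum
  rcases h23 with h | h
  · exact AbelianVariety.isDivisorGenerated_powSucc_of_ribetTypeTwentyThreeFortyFour A φ hd hφ hE2 h (by omega) N
  · exact AbelianVariety.isDivisorGenerated_powSucc_of_ribetTypeTwentyThreeFortyFour' A φ hd hφ hE2 (by omega) h N

/-- **The Hodge conjecture for all powers of a 67-FOLD of signature `{23, 44}` — UNCONDITIONAL.**
[cite: Ribet1983, Thm. 3] [cite: Deligne2000, §1] -/
theorem hodgeConjectureFor_powSucc_of_sixtysevenfold_twentyThreeFortyFour (A : AbelianVariety ℂ)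
    (φ : A ⟶ A) {d : ℕ} (hd : 0 < d) (hφ : φ ≫ φ = -(d • 𝟙 A)) (hE2 : Module.finrank ℚ A.endAlgebra = 2)
    (hX : A.dim = 67)
    (h23 : eigenMultiplicity A φ (Complex.I * (Real.sqrt d : ℂ)) = 23 ∨
      eigenMultiplicity A φ (-(Complex.I * (Real.sqrt d : ℂ))) = 23)
    (N : ℕ) : HodgeConjectureFor (A.powSucc N).dim (A.powSucc N).X :=
  hodgeConjectureFor_of_isDivisorGenerated _
    (AbelianVariety.isDivisorGenerated_powSucc_of_sixtysevenfold_twentyThreeFortyFour A φ hd hφ hE2 hX h23 N)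

/-- **Ribet 1983 Thm. 3 at `(n′, n″) = (25, 42)` — UNCONDITIONAL** (core `UnitaryTwentyFiveFortyTwo.eq_top_of_smul`).
[cite: Ribet1983, Thm. 0 and Thm. 3] [cite: Gordon1997, Thm. 6.3 (3) and Corollary] -/
theorem AbelianVariety.isDivisorGenerated_powSucc_of_ribetTypeTwentyFiveFortyTwo (A : AbelianVariety ℂ) (φ : A ⟶ A)
    {d : ℕ} (hd : 0 < d) (hφ : φ ≫ φ = -(d • 𝟙 A)) (hE2 : Module.finrank ℚ A.endAlgebra = 2)
    (h25 : eigenMultiplicity A φ (Complex.I * (Real.sqrt d : ℂ)) = 25)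
    (h42 : eigenMultiplicity A φ (-(Complex.I * (Real.sqrt d : ℂ))) = 42) (N : ℕ) :
    IsDivisorGenerated (A.powSucc N) := by
  refine AbelianVariety.isDivisorGenerated_powSucc_of_ribetType_ofCoreSmul A φ hd hφ hE2 (by omega) (by omega) ?_ N
  intro W' _ _ _ 𝔊 ι P' Q' s hbr hirr hι hιι hP' hQ' hfinP' hfinQ' hadd hsmul hsymm hPQ hdefP hdefQ hadj
  exact UnitaryTwentyFiveFortyTwo.eq_top_of_smul hbr hirr hι hιι hP' hQ' (by rw [hfinP', h25]) (by rw [hfinQ', h42]) hadd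
    hsmul hsymm hPQ hdefP hdefQ hadj

/-- The mirror: `n_{i√d}(φ) = 42`, `n_{−i√d}(φ) = 25` (core `UnitaryTwentyFiveFortyTwo.eq_top_of_smul'`).
[cite: Ribet1983, Thm. 0 and Thm. 3] [cite: Gordon1997, Thm. 6.3 (3) and Corollary] -/
theorem AbelianVariety.isDivisorGenerated_powSucc_of_ribetTypeTwentyFiveFortyTwo' (A : AbelianVariety ℂ) (φ : A ⟶ A)
    {d : ℕ} (hd : 0 < d) (hφ : φ ≫ φ = -(d • 𝟙 A)) (hE2 : Module.finrank ℚ A.endAlgebra = 2)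
    (h42 : eigenMultiplicity A φ (Complex.I * (Real.sqrt d : ℂ)) = 42)
    (h25 : eigenMultiplicity A φ (-(Complex.I * (Real.sqrt d : ℂ))) = 25) (N : ℕ) :
    IsDivisorGenerated (A.powSucc N) := by
  refine AbelianVariety.isDivisorGenerated_powSucc_of_ribetType_ofCoreSmul A φ hd hφ hE2 (by omega) (by omega) ?_ N
  intro W' _ _ _ 𝔊 ι P' Q' s hbr hirr hι hιι hP' hQ' hfinP' hfinQ' hadd hsmul hsymm hPQ hdefP hdefQ hadj
  exact UnitaryTwentyFiveFortyTwo.eq_top_of_smul' hbr hirr hι hιι hP' hQ' (by rw [hfinP', h42]) (by rw [hfinQ', h25])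
    hadd hsmul hsymm hPQ hdefP hdefQ hadj

/-- **The Hodge conjecture for all powers `A^{N+1}` of an abelian variety of Ribet type `(25, 42)` — UNCONDITIONAL.**
[cite: Ribet1983, Thm. 3] [cite: Deligne2000, §1] -/
theorem hodgeConjectureFor_powSucc_of_ribetTypeTwentyFiveFortyTwo (A : AbelianVariety ℂ) (φ : A ⟶ A)
    {d : ℕ} (hd : 0 < d) (hφ : φ ≫ φ = -(d • 𝟙 A)) (hE2 : Module.finrank ℚ A.endAlgebra = 2)
    (h25 : eigenMultiplicity A φ (Complex.I * (Real.sqrt d : ℂ)) = 25)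
    (h42 : eigenMultiplicity A φ (-(Complex.I * (Real.sqrt d : ℂ))) = 42) (N : ℕ) :
    HodgeConjectureFor (A.powSucc N).dim (A.powSucc N).X :=
  hodgeConjectureFor_of_isDivisorGenerated _
    (AbelianVariety.isDivisorGenerated_powSucc_of_ribetTypeTwentyFiveFortyTwo A φ hd hφ hE2 h25 h42 N)

/-- **67-FOLDS of signature `{25, 42}`: `B• = D•` on all powers — UNCONDITIONAL** (either eigenvalue may carry the `25`).
[cite: Ribet1983, Thm. 0 and Thm. 3] [cite: MoonenZarhin1999LowDim, §2 (2.4)] -/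
theorem AbelianVariety.isDivisorGenerated_powSucc_of_sixtysevenfold_twentyFiveFortyTwo (A : AbelianVariety ℂ)
    (φ : A ⟶ A) {d : ℕ} (hd : 0 < d) (hφ : φ ≫ φ = -(d • 𝟙 A)) (hE2 : Module.finrank ℚ A.endAlgebra = 2)
    (hX : A.dim = 67)
    (h25 : eigenMultiplicity A φ (Complex.I * (Real.sqrt d : ℂ)) = 25 ∨
      eigenMultiplicity A φ (-(Complex.I * (Real.sqrt d : ℂ))) = 25)
    (N : ℕ) : IsDivisorGenerated (A.powSucc N) := by
  have hsum := eigenMultiplicity_add_eigenMultiplicity_neg_eq_dim A φ hd hφ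
  rw [hX] at hsum
  rcases h25 with h | h
  · exact AbelianVariety.isDivisorGenerated_powSucc_of_ribetTypeTwentyFiveFortyTwo A φ hd hφ hE2 h (by omega) N
  · exact AbelianVariety.isDivisorGenerated_powSucc_of_ribetTypeTwentyFiveFortyTwo' A φ hd hφ hE2 (by omega) h N

/-- **The Hodge conjecture for all powers of a 67-FOLD of signature `{25, 42}` — UNCONDITIONAL.**
[cite: Ribet1983, Thm. 3] [cite: Deligne2000, §1] -/
theorem hodgeConjectureFor_powSucc_of_sixtysevenfold_twentyFiveFortyTwo (A : AbelianVariety ℂ)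
    (φ : A ⟶ A) {d : ℕ} (hd : 0 < d) (hφ : φ ≫ φ = -(d • 𝟙 A)) (hE2 : Module.finrank ℚ A.endAlgebra = 2)
    (hX : A.dim = 67)
    (h25 : eigenMultiplicity A φ (Complex.I * (Real.sqrt d : ℂ)) = 25 ∨
      eigenMultiplicity A φ (-(Complex.I * (Real.sqrt d : ℂ))) = 25)
    (N : ℕ) : HodgeConjectureFor (A.powSucc N).dim (A.powSucc N).X :=
  hodgeConjectureFor_of_isDivisorGenerated _
    (AbelianVariety.isDivisorGenerated_powSucc_of_sixtysevenfold_twentyFiveFortyTwo A φ hd hφ hE2 hX h25 N)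

/-- **Ribet 1983 Thm. 3 at `(n′, n″) = (27, 40)` — UNCONDITIONAL** (core `UnitaryTwentySevenForty.eq_top_of_smul`).
[cite: Ribet1983, Thm. 0 and Thm. 3] [cite: Gordon1997, Thm. 6.3 (3) and Corollary] -/
theorem AbelianVariety.isDivisorGenerated_powSucc_of_ribetTypeTwentySevenForty (A : AbelianVariety ℂ) (φ : A ⟶ A)
    {d : ℕ} (hd : 0 < d) (hφ : φ ≫ φ = -(d • 𝟙 A)) (hE2 : Module.finrank ℚ A.endAlgebra = 2)
    (h27 : eigenMultiplicity A φ (Complex.I * (Real.sqrt d : ℂ)) = 27)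
    (h40 : eigenMultiplicity A φ (-(Complex.I * (Real.sqrt d : ℂ))) = 40) (N : ℕ) :
    IsDivisorGenerated (A.powSucc N) := by
  refine AbelianVariety.isDivisorGenerated_powSucc_of_ribetType_ofCoreSmul A φ hd hφ hE2 (by omega) (by omega) ?_ N
  intro W' _ _ _ 𝔊 ι P' Q' s hbr hirr hι hιι hP' hQ' hfinP' hfinQ' hadd hsmul hsymm hPQ hdefP hdefQ hadj
  exact UnitaryTwentySevenForty.eq_top_of_smul hbr hirr hι hιι hP' hQ' (by rw [hfinP', h27]) (by rw [hfinQ', h40]) hadd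
    hsmul hsymm hPQ hdefP hdefQ hadj

/-- The mirror: `n_{i√d}(φ) = 40`, `n_{−i√d}(φ) = 27` (core `UnitaryTwentySevenForty.eq_top_of_smul'`).
[cite: Ribet1983, Thm. 0 and Thm. 3] [cite: Gordon1997, Thm. 6.3 (3) and Corollary] -/
theorem AbelianVariety.isDivisorGenerated_powSucc_of_ribetTypeTwentySevenForty' (A : AbelianVariety ℂ) (φ : A ⟶ A)
    {d : ℕ} (hd : 0 < d) (hφ : φ ≫ φ = -(d • 𝟙 A)) (hE2 : Module.finrank ℚ A.endAlgebra = 2)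
    (h40 : eigenMultiplicity A φ (Complex.I * (Real.sqrt d : ℂ)) = 40)
    (h27 : eigenMultiplicity A φ (-(Complex.I * (Real.sqrt d : ℂ))) = 27) (N : ℕ) :
    IsDivisorGenerated (A.powSucc N) := by
  refine AbelianVariety.isDivisorGenerated_powSucc_of_ribetType_ofCoreSmul A φ hd hφ hE2 (by omega) (by omega) ?_ N
  intro W' _ _ _ 𝔊 ι P' Q' s hbr hirr hι hιι hP' hQ' hfinP' hfinQ' hadd hsmul hsymm hPQ hdefP hdefQ hadj
  exact UnitaryTwentySevenForty.eq_top_of_smul' hbr hirr hι hιι hP' hQ' (by rw [hfinP', h40]) (by rw [hfinQ', h27])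
    hadd hsmul hsymm hPQ hdefP hdefQ hadj

/-- **The Hodge conjecture for all powers `A^{N+1}` of an abelian variety of Ribet type `(27, 40)` — UNCONDITIONAL.**
[cite: Ribet1983, Thm. 3] [cite: Deligne2000, §1] -/
theorem hodgeConjectureFor_powSucc_of_ribetTypeTwentySevenForty (A : AbelianVariety ℂ) (φ : A ⟶ A)
    {d : ℕ} (hd : 0 < d) (hφ : φ ≫ φ = -(d • 𝟙 A)) (hE2 : Module.finrank ℚ A.endAlgebra = 2)
    (h27 : eigenMultiplicity A φ (Complex.I * (Real.sqrt d : ℂ)) = 27)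
    (h40 : eigenMultiplicity A φ (-(Complex.I * (Real.sqrt d : ℂ))) = 40) (N : ℕ) :
    HodgeConjectureFor (A.powSucc N).dim (A.powSucc N).X :=
  hodgeConjectureFor_of_isDivisorGenerated _
    (AbelianVariety.isDivisorGenerated_powSucc_of_ribetTypeTwentySevenForty A φ hd hφ hE2 h27 h40 N)

/-- **67-FOLDS of signature `{27, 40}`: `B• = D•` on all powers — UNCONDITIONAL** (either eigenvalue may carry the `27`).
[cite: Ribet1983, Thm. 0 and Thm. 3] [cite: MoonenZarhin1999LowDim, §2 (2.4)] -/
theorem AbelianVariety.isDivisorGenerated_powSucc_of_sixtysevenfold_twentySevenForty (A : AbelianVariety ℂ)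
    (φ : A ⟶ A) {d : ℕ} (hd : 0 < d) (hφ : φ ≫ φ = -(d • 𝟙 A)) (hE2 : Module.finrank ℚ A.endAlgebra = 2)
    (hX : A.dim = 67)
    (h27 : eigenMultiplicity A φ (Complex.I * (Real.sqrt d : ℂ)) = 27 ∨
      eigenMultiplicity A φ (-(Complex.I * (Real.sqrt d : ℂ))) = 27)
    (N : ℕ) : IsDivisorGenerated (A.powSucc N) := by
  have hsum := eigenMultiplicity_add_eigenMultiplicity_neg_eq_dim A φ hd hφ
  rw [hX] at hsum
  rcases h27 with h | h
  · exact AbelianVariety.isDivisorGenerated_powSucc_of_ribetTypeTwentySevenForty A φ hd hφ hE2 h (by omega) N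
  · exact AbelianVariety.isDivisorGenerated_powSucc_of_ribetTypeTwentySevenForty' A φ hd hφ hE2 (by omega) h N

/-- **The Hodge conjecture for all powers of a 67-FOLD of signature `{27, 40}` — UNCONDITIONAL.**
[cite: Ribet1983, Thm. 3] [cite: Deligne2000, §1] -/
theorem hodgeConjectureFor_powSucc_of_sixtysevenfold_twentySevenForty (A : AbelianVariety ℂ)
    (φ : A ⟶ A) {d : ℕ} (hd : 0 < d) (hφ : φ ≫ φ = -(d • 𝟙 A)) (hE2 : Module.finrank ℚ A.endAlgebra = 2)
    (hX : A.dim = 67)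
    (h27 : eigenMultiplicity A φ (Complex.I * (Real.sqrt d : ℂ)) = 27 ∨
      eigenMultiplicity A φ (-(Complex.I * (Real.sqrt d : ℂ))) = 27)
    (N : ℕ) : HodgeConjectureFor (A.powSucc N).dim (A.powSucc N).X :=
  hodgeConjectureFor_of_isDivisorGenerated _
    (AbelianVariety.isDivisorGenerated_powSucc_of_sixtysevenfold_twentySevenForty A φ hd hφ hE2 hX h27 N)

/-- **Ribet 1983 Thm. 3 at `(n′, n″) = (28, 39)` — UNCONDITIONAL** (core `UnitaryTwentyEightThirtyNine.eq_top_of_smul`).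
[cite: Ribet1983, Thm. 0 and Thm. 3] [cite: Gordon1997, Thm. 6.3 (3) and Corollary] -/
theorem AbelianVariety.isDivisorGenerated_powSucc_of_ribetTypeTwentyEightThirtyNine (A : AbelianVariety ℂ) (φ : A ⟶ A)
    {d : ℕ} (hd : 0 < d) (hφ : φ ≫ φ = -(d • 𝟙 A)) (hE2 : Module.finrank ℚ A.endAlgebra = 2)
    (h28 : eigenMultiplicity A φ (Complex.I * (Real.sqrt d : ℂ)) = 28)
    (h39 : eigenMultiplicity A φ (-(Complex.I * (Real.sqrt d : ℂ))) = 39) (N : ℕ) :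
    IsDivisorGenerated (A.powSucc N) := by
  refine AbelianVariety.isDivisorGenerated_powSucc_of_ribetType_ofCoreSmul A φ hd hφ hE2 (by omega) (by omega) ?_ N
  intro W' _ _ _ 𝔊 ι P' Q' s hbr hirr hι hιι hP' hQ' hfinP' hfinQ' hadd hsmul hsymm hPQ hdefP hdefQ hadj
  exact UnitaryTwentyEightThirtyNine.eq_top_of_smul hbr hirr hι hιι hP' hQ' (by rw [hfinP', h28]) (by rw [hfinQ', h39]) hadd
    hsmul hsymm hPQ hdefP hdefQ hadj

/-- The mirror: `n_{i√d}(φ) = 39`, `n_{−i√d}(φ) = 28` (core `UnitaryTwentyEightThirtyNine.eq_top_of_smul'`).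
[cite: Ribet1983, Thm. 0 and Thm. 3] [cite: Gordon1997, Thm. 6.3 (3) and Corollary] -/
theorem AbelianVariety.isDivisorGenerated_powSucc_of_ribetTypeTwentyEightThirtyNine' (A : AbelianVariety ℂ) (φ : A ⟶ A)
    {d : ℕ} (hd : 0 < d) (hφ : φ ≫ φ = -(d • 𝟙 A)) (hE2 : Module.finrank ℚ A.endAlgebra = 2)
    (h39 : eigenMultiplicity A φ (Complex.I * (Real.sqrt d : ℂ)) = 39)
    (h28 : eigenMultiplicity A φ (-(Complex.I * (Real.sqrt d : ℂ))) = 28) (N : ℕ) :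
    IsDivisorGenerated (A.powSucc N) := by
  refine AbelianVariety.isDivisorGenerated_powSucc_of_ribetType_ofCoreSmul A φ hd hφ hE2 (by omega) (by omega) ?_ N
  intro W' _ _ _ 𝔊 ι P' Q' s hbr hirr hι hιι hP' hQ' hfinP' hfinQ' hadd hsmul hsymm hPQ hdefP hdefQ hadj
  exact UnitaryTwentyEightThirtyNine.eq_top_of_smul' hbr hirr hι hιι hP' hQ' (by rw [hfinP', h39]) (by rw [hfinQ', h28])
    hadd hsmul hsymm hPQ hdefP hdefQ hadj

/-- **The Hodge conjecture for all powers `A^{N+1}` of an abelian variety of Ribet type `(28, 39)` — UNCONDITIONAL.**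
[cite: Ribet1983, Thm. 3] [cite: Deligne2000, §1] -/
theorem hodgeConjectureFor_powSucc_of_ribetTypeTwentyEightThirtyNine (A : AbelianVariety ℂ) (φ : A ⟶ A)
    {d : ℕ} (hd : 0 < d) (hφ : φ ≫ φ = -(d • 𝟙 A)) (hE2 : Module.finrank ℚ A.endAlgebra = 2)
    (h28 : eigenMultiplicity A φ (Complex.I * (Real.sqrt d : ℂ)) = 28)
    (h39 : eigenMultiplicity A φ (-(Complex.I * (Real.sqrt d : ℂ))) = 39) (N : ℕ) :
    HodgeConjectureFor (A.powSucc N).dim (A.powSucc N).X :=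
  hodgeConjectureFor_of_isDivisorGenerated _
    (AbelianVariety.isDivisorGenerated_powSucc_of_ribetTypeTwentyEightThirtyNine A φ hd hφ hE2 h28 h39 N)

/-- **67-FOLDS of signature `{28, 39}`: `B• = D•` on all powers — UNCONDITIONAL** (either eigenvalue may carry the `28`).
[cite: Ribet1983, Thm. 0 and Thm. 3] [cite: MoonenZarhin1999LowDim, §2 (2.4)] -/
theorem AbelianVariety.isDivisorGenerated_powSucc_of_sixtysevenfold_twentyEightThirtyNine (A : AbelianVariety ℂ)
    (φ : A ⟶ A) {d : ℕ} (hd : 0 < d) (hφ : φ ≫ φ = -(d • 𝟙 A)) (hE2 : Module.finrank ℚ A.endAlgebra = 2)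
    (hX : A.dim = 67)
    (h28 : eigenMultiplicity A φ (Complex.I * (Real.sqrt d : ℂ)) = 28 ∨
      eigenMultiplicity A φ (-(Complex.I * (Real.sqrt d : ℂ))) = 28)
    (N : ℕ) : IsDivisorGenerated (A.powSucc N) := by
  have hsum := eigenMultiplicity_add_eigenMultiplicity_neg_eq_dim A φ hd hφ
  rw [hX] at hsum
  rcases h28 with h | h
  · exact AbelianVariety.isDivisorGenerated_powSucc_of_ribetTypeTwentyEightThirtyNine A φ hd hφ hE2 h (by omega) N
  · exact AbelianVariety.isDivisorGenerated_powSucc_of_ribetTypeTwentyEightThirtyNine' A φ hd hφ hE2 (by omega) h N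

/-- **The Hodge conjecture for all powers of a 67-FOLD of signature `{28, 39}` — UNCONDITIONAL.**
[cite: Ribet1983, Thm. 3] [cite: Deligne2000, §1] -/
theorem hodgeConjectureFor_powSucc_of_sixtysevenfold_twentyEightThirtyNine (A : AbelianVariety ℂ)
    (φ : A ⟶ A) {d : ℕ} (hd : 0 < d) (hφ : φ ≫ φ = -(d • 𝟙 A)) (hE2 : Module.finrank ℚ A.endAlgebra = 2)
    (hX : A.dim = 67)
    (h28 : eigenMultiplicity A φ (Complex.I * (Real.sqrt d : ℂ)) = 28 ∨
      eigenMultiplicity A φ (-(Complex.I * (Real.sqrt d : ℂ))) = 28)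
    (N : ℕ) : HodgeConjectureFor (A.powSucc N).dim (A.powSucc N).X :=
  hodgeConjectureFor_of_isDivisorGenerated _
    (AbelianVariety.isDivisorGenerated_powSucc_of_sixtysevenfold_twentyEightThirtyNine A φ hd hφ hE2 hX h28 N)

/-- **Ribet 1983 Thm. 3 at `(n′, n″) = (29, 38)` — UNCONDITIONAL** (core `UnitaryTwentyNineThirtyEight.eq_top_of_smul`).
[cite: Ribet1983, Thm. 0 and Thm. 3] [cite: Gordon1997, Thm. 6.3 (3) and Corollary] -/
theorem AbelianVariety.isDivisorGenerated_powSucc_of_ribetTypeTwentyNineThirtyEight (A : AbelianVariety ℂ) (φ : A ⟶ A)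
    {d : ℕ} (hd : 0 < d) (hφ : φ ≫ φ = -(d • 𝟙 A)) (hE2 : Module.finrank ℚ A.endAlgebra = 2)
    (h29 : eigenMultiplicity A φ (Complex.I * (Real.sqrt d : ℂ)) = 29)
    (h38 : eigenMultiplicity A φ (-(Complex.I * (Real.sqrt d : ℂ))) = 38) (N : ℕ) :
    IsDivisorGenerated (A.powSucc N) := by
  refine AbelianVariety.isDivisorGenerated_powSucc_of_ribetType_ofCoreSmul A φ hd hφ hE2 (by omega) (by omega) ?_ N
  intro W' _ _ _ 𝔊 ι P' Q' s hbr hirr hι hιι hP' hQ' hfinP' hfinQ' hadd hsmul hsymm hPQ hdefP hdefQ hadj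
  exact UnitaryTwentyNineThirtyEight.eq_top_of_smul hbr hirr hι hιι hP' hQ' (by rw [hfinP', h29]) (by rw [hfinQ', h38]) hadd
    hsmul hsymm hPQ hdefP hdefQ hadj

/-- The mirror: `n_{i√d}(φ) = 38`, `n_{−i√d}(φ) = 29` (core `UnitaryTwentyNineThirtyEight.eq_top_of_smul'`).
[cite: Ribet1983, Thm. 0 and Thm. 3] [cite: Gordon1997, Thm. 6.3 (3) and Corollary] -/
theorem AbelianVariety.isDivisorGenerated_powSucc_of_ribetTypeTwentyNineThirtyEight' (A : AbelianVariety ℂ) (φ : A ⟶ A)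
    {d : ℕ} (hd : 0 < d) (hφ : φ ≫ φ = -(d • 𝟙 A)) (hE2 : Module.finrank ℚ A.endAlgebra = 2)
    (h38 : eigenMultiplicity A φ (Complex.I * (Real.sqrt d : ℂ)) = 38)
    (h29 : eigenMultiplicity A φ (-(Complex.I * (Real.sqrt d : ℂ))) = 29) (N : ℕ) :
    IsDivisorGenerated (A.powSucc N) := by
  refine AbelianVariety.isDivisorGenerated_powSucc_of_ribetType_ofCoreSmul A φ hd hφ hE2 (by omega) (by omega) ?_ N
  intro W' _ _ _ 𝔊 ι P' Q' s hbr hirr hι hιι hP' hQ' hfinP' hfinQ' hadd hsmul hsymm hPQ hdefP hdefQ hadj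
  exact UnitaryTwentyNineThirtyEight.eq_top_of_smul' hbr hirr hι hιι hP' hQ' (by rw [hfinP', h38]) (by rw [hfinQ', h29])
    hadd hsmul hsymm hPQ hdefP hdefQ hadj

/-- **The Hodge conjecture for all powers `A^{N+1}` of an abelian variety of Ribet type `(29, 38)` — UNCONDITIONAL.**
[cite: Ribet1983, Thm. 3] [cite: Deligne2000, §1] -/
theorem hodgeConjectureFor_powSucc_of_ribetTypeTwentyNineThirtyEight (A : AbelianVariety ℂ) (φ : A ⟶ A)
    {d : ℕ} (hd : 0 < d) (hφ : φ ≫ φ = -(d • 𝟙 A)) (hE2 : Module.finrank ℚ A.endAlgebra = 2)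
    (h29 : eigenMultiplicity A φ (Complex.I * (Real.sqrt d : ℂ)) = 29)
    (h38 : eigenMultiplicity A φ (-(Complex.I * (Real.sqrt d : ℂ))) = 38) (N : ℕ) :
    HodgeConjectureFor (A.powSucc N).dim (A.powSucc N).X :=
  hodgeConjectureFor_of_isDivisorGenerated _
    (AbelianVariety.isDivisorGenerated_powSucc_of_ribetTypeTwentyNineThirtyEight A φ hd hφ hE2 h29 h38 N)

/-- **67-FOLDS of signature `{29, 38}`: `B• = D•` on all powers — UNCONDITIONAL** (either eigenvalue may carry the `29`).
[cite: Ribet1983, Thm. 0 and Thm. 3] [cite: MoonenZarhin1999LowDim, §2 (2.4)] -/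
theorem AbelianVariety.isDivisorGenerated_powSucc_of_sixtysevenfold_twentyNineThirtyEight (A : AbelianVariety ℂ)
    (φ : A ⟶ A) {d : ℕ} (hd : 0 < d) (hφ : φ ≫ φ = -(d • 𝟙 A)) (hE2 : Module.finrank ℚ A.endAlgebra = 2)
    (hX : A.dim = 67)
    (h29 : eigenMultiplicity A φ (Complex.I * (Real.sqrt d : ℂ)) = 29 ∨
      eigenMultiplicity A φ (-(Complex.I * (Real.sqrt d : ℂ))) = 29)
    (N : ℕ) : IsDivisorGenerated (A.powSucc N) := by
  have hsum := eigenMultiplicity_add_eigenMultiplicity_neg_eq_dim A φ hd hφ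
  rw [hX] at hsum
  rcases h29 with h | h
  · exact AbelianVariety.isDivisorGenerated_powSucc_of_ribetTypeTwentyNineThirtyEight A φ hd hφ hE2 h (by omega) N
  · exact AbelianVariety.isDivisorGenerated_powSucc_of_ribetTypeTwentyNineThirtyEight' A φ hd hφ hE2 (by omega) h N

/-- **The Hodge conjecture for all powers of a 67-FOLD of signature `{29, 38}` — UNCONDITIONAL.**
[cite: Ribet1983, Thm. 3] [cite: Deligne2000, §1] -/
theorem hodgeConjectureFor_powSucc_of_sixtysevenfold_twentyNineThirtyEight (A : AbelianVariety ℂ)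
    (φ : A ⟶ A) {d : ℕ} (hd : 0 < d) (hφ : φ ≫ φ = -(d • 𝟙 A)) (hE2 : Module.finrank ℚ A.endAlgebra = 2)
    (hX : A.dim = 67)
    (h29 : eigenMultiplicity A φ (Complex.I * (Real.sqrt d : ℂ)) = 29 ∨
      eigenMultiplicity A φ (-(Complex.I * (Real.sqrt d : ℂ))) = 29)
    (N : ℕ) : HodgeConjectureFor (A.powSucc N).dim (A.powSucc N).X :=
  hodgeConjectureFor_of_isDivisorGenerated _
    (AbelianVariety.isDivisorGenerated_powSucc_of_sixtysevenfold_twentyNineThirtyEight A φ hd hφ hE2 hX h29 N)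

/-- **Ribet 1983 Thm. 3 at `(n′, n″) = (31, 36)` — UNCONDITIONAL** (core `UnitaryThirtyOneThirtySix.eq_top_of_smul`).
[cite: Ribet1983, Thm. 0 and Thm. 3] [cite: Gordon1997, Thm. 6.3 (3) and Corollary] -/
theorem AbelianVariety.isDivisorGenerated_powSucc_of_ribetTypeThirtyOneThirtySix (A : AbelianVariety ℂ) (φ : A ⟶ A)
    {d : ℕ} (hd : 0 < d) (hφ : φ ≫ φ = -(d • 𝟙 A)) (hE2 : Module.finrank ℚ A.endAlgebra = 2)
    (h31 : eigenMultiplicity A φ (Complex.I * (Real.sqrt d : ℂ)) = 31)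
    (h36 : eigenMultiplicity A φ (-(Complex.I * (Real.sqrt d : ℂ))) = 36) (N : ℕ) :
    IsDivisorGenerated (A.powSucc N) := by
  refine AbelianVariety.isDivisorGenerated_powSucc_of_ribetType_ofCoreSmul A φ hd hφ hE2 (by omega) (by omega) ?_ N
  intro W' _ _ _ 𝔊 ι P' Q' s hbr hirr hι hιι hP' hQ' hfinP' hfinQ' hadd hsmul hsymm hPQ hdefP hdefQ hadj
  exact UnitaryThirtyOneThirtySix.eq_top_of_smul hbr hirr hι hιι hP' hQ' (by rw [hfinP', h31]) (by rw [hfinQ', h36]) hadd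
    hsmul hsymm hPQ hdefP hdefQ hadj

/-- The mirror: `n_{i√d}(φ) = 36`, `n_{−i√d}(φ) = 31` (core `UnitaryThirtyOneThirtySix.eq_top_of_smul'`).
[cite: Ribet1983, Thm. 0 and Thm. 3] [cite: Gordon1997, Thm. 6.3 (3) and Corollary] -/
theorem AbelianVariety.isDivisorGenerated_powSucc_of_ribetTypeThirtyOneThirtySix' (A : AbelianVariety ℂ) (φ : A ⟶ A)
    {d : ℕ} (hd : 0 < d) (hφ : φ ≫ φ = -(d • 𝟙 A)) (hE2 : Module.finrank ℚ A.endAlgebra = 2)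
    (h36 : eigenMultiplicity A φ (Complex.I * (Real.sqrt d : ℂ)) = 36)
    (h31 : eigenMultiplicity A φ (-(Complex.I * (Real.sqrt d : ℂ))) = 31) (N : ℕ) :
    IsDivisorGenerated (A.powSucc N) := by
  refine AbelianVariety.isDivisorGenerated_powSucc_of_ribetType_ofCoreSmul A φ hd hφ hE2 (by omega) (by omega) ?_ N
  intro W' _ _ _ 𝔊 ι P' Q' s hbr hirr hι hιι hP' hQ' hfinP' hfinQ' hadd hsmul hsymm hPQ hdefP hdefQ hadj
  exact UnitaryThirtyOneThirtySix.eq_top_of_smul' hbr hirr hι hιι hP' hQ' (by rw [hfinP', h36]) (by rw [hfinQ', h31])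
    hadd hsmul hsymm hPQ hdefP hdefQ hadj

/-- **The Hodge conjecture for all powers `A^{N+1}` of an abelian variety of Ribet type `(31, 36)` — UNCONDITIONAL.**
[cite: Ribet1983, Thm. 3] [cite: Deligne2000, §1] -/
theorem hodgeConjectureFor_powSucc_of_ribetTypeThirtyOneThirtySix (A : AbelianVariety ℂ) (φ : A ⟶ A)
    {d : ℕ} (hd : 0 < d) (hφ : φ ≫ φ = -(d • 𝟙 A)) (hE2 : Module.finrank ℚ A.endAlgebra = 2)
    (h31 : eigenMultiplicity A φ (Complex.I * (Real.sqrt d : ℂ)) = 31)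
    (h36 : eigenMultiplicity A φ (-(Complex.I * (Real.sqrt d : ℂ))) = 36) (N : ℕ) :
    HodgeConjectureFor (A.powSucc N).dim (A.powSucc N).X :=
  hodgeConjectureFor_of_isDivisorGenerated _
    (AbelianVariety.isDivisorGenerated_powSucc_of_ribetTypeThirtyOneThirtySix A φ hd hφ hE2 h31 h36 N)

/-- **67-FOLDS of signature `{31, 36}`: `B• = D•` on all powers — UNCONDITIONAL** (either eigenvalue may carry the `31`).
[cite: Ribet1983, Thm. 0 and Thm. 3] [cite: MoonenZarhin1999LowDim, §2 (2.4)] -/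
theorem AbelianVariety.isDivisorGenerated_powSucc_of_sixtysevenfold_thirtyOneThirtySix (A : AbelianVariety ℂ)
    (φ : A ⟶ A) {d : ℕ} (hd : 0 < d) (hφ : φ ≫ φ = -(d • 𝟙 A)) (hE2 : Module.finrank ℚ A.endAlgebra = 2)
    (hX : A.dim = 67)
    (h31 : eigenMultiplicity A φ (Complex.I * (Real.sqrt d : ℂ)) = 31 ∨
      eigenMultiplicity A φ (-(Complex.I * (Real.sqrt d : ℂ))) = 31)
    (N : ℕ) : IsDivisorGenerated (A.powSucc N) := by
  have hsum := eigenMultiplicity_add_eigenMultiplicity_neg_eq_dim A φ hd hφ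
  rw [hX] at hsum
  rcases h31 with h | h
  · exact AbelianVariety.isDivisorGenerated_powSucc_of_ribetTypeThirtyOneThirtySix A φ hd hφ hE2 h (by omega) N
  · exact AbelianVariety.isDivisorGenerated_powSucc_of_ribetTypeThirtyOneThirtySix' A φ hd hφ hE2 (by omega) h N

/-- **The Hodge conjecture for all powers of a 67-FOLD of signature `{31, 36}` — UNCONDITIONAL.**
[cite: Ribet1983, Thm. 3] [cite: Deligne2000, §1] -/
theorem hodgeConjectureFor_powSucc_of_sixtysevenfold_thirtyOneThirtySix (A : AbelianVariety ℂ)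
    (φ : A ⟶ A) {d : ℕ} (hd : 0 < d) (hφ : φ ≫ φ = -(d • 𝟙 A)) (hE2 : Module.finrank ℚ A.endAlgebra = 2)
    (hX : A.dim = 67)
    (h31 : eigenMultiplicity A φ (Complex.I * (Real.sqrt d : ℂ)) = 31 ∨
      eigenMultiplicity A φ (-(Complex.I * (Real.sqrt d : ℂ))) = 31)
    (N : ℕ) : HodgeConjectureFor (A.powSucc N).dim (A.powSucc N).X :=
  hodgeConjectureFor_of_isDivisorGenerated _
    (AbelianVariety.isDivisorGenerated_powSucc_of_sixtysevenfold_thirtyOneThirtySix A φ hd hφ hE2 hX h31 N)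

/-- **Ribet 1983 Thm. 3 at `(n′, n″) = (32, 35)` — UNCONDITIONAL** (core `UnitaryThirtyTwoThirtyFive.eq_top_of_smul`).
[cite: Ribet1983, Thm. 0 and Thm. 3] [cite: Gordon1997, Thm. 6.3 (3) and Corollary] -/
theorem AbelianVariety.isDivisorGenerated_powSucc_of_ribetTypeThirtyTwoThirtyFive (A : AbelianVariety ℂ) (φ : A ⟶ A)
    {d : ℕ} (hd : 0 < d) (hφ : φ ≫ φ = -(d • 𝟙 A)) (hE2 : Module.finrank ℚ A.endAlgebra = 2)
    (h32 : eigenMultiplicity A φ (Complex.I * (Real.sqrt d : ℂ)) = 32)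
    (h35 : eigenMultiplicity A φ (-(Complex.I * (Real.sqrt d : ℂ))) = 35) (N : ℕ) :
    IsDivisorGenerated (A.powSucc N) := by
  refine AbelianVariety.isDivisorGenerated_powSucc_of_ribetType_ofCoreSmul A φ hd hφ hE2 (by omega) (by omega) ?_ N
  intro W' _ _ _ 𝔊 ι P' Q' s hbr hirr hι hιι hP' hQ' hfinP' hfinQ' hadd hsmul hsymm hPQ hdefP hdefQ hadj
  exact UnitaryThirtyTwoThirtyFive.eq_top_of_smul hbr hirr hι hιι hP' hQ' (by rw [hfinP', h32]) (by rw [hfinQ', h35]) hadd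
    hsmul hsymm hPQ hdefP hdefQ hadj

/-- The mirror: `n_{i√d}(φ) = 35`, `n_{−i√d}(φ) = 32` (core `UnitaryThirtyTwoThirtyFive.eq_top_of_smul'`).
[cite: Ribet1983, Thm. 0 and Thm. 3] [cite: Gordon1997, Thm. 6.3 (3) and Corollary] -/
theorem AbelianVariety.isDivisorGenerated_powSucc_of_ribetTypeThirtyTwoThirtyFive' (A : AbelianVariety ℂ) (φ : A ⟶ A)
    {d : ℕ} (hd : 0 < d) (hφ : φ ≫ φ = -(d • 𝟙 A)) (hE2 : Module.finrank ℚ A.endAlgebra = 2)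
    (h35 : eigenMultiplicity A φ (Complex.I * (Real.sqrt d : ℂ)) = 35)
    (h32 : eigenMultiplicity A φ (-(Complex.I * (Real.sqrt d : ℂ))) = 32) (N : ℕ) :
    IsDivisorGenerated (A.powSucc N) := by
  refine AbelianVariety.isDivisorGenerated_powSucc_of_ribetType_ofCoreSmul A φ hd hφ hE2 (by omega) (by omega) ?_ N
  intro W' _ _ _ 𝔊 ι P' Q' s hbr hirr hι hιι hP' hQ' hfinP' hfinQ' hadd hsmul hsymm hPQ hdefP hdefQ hadj
  exact UnitaryThirtyTwoThirtyFive.eq_top_of_smul' hbr hirr hι hιι hP' hQ' (by rw [hfinP', h35]) (by rw [hfinQ', h32])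
    hadd hsmul hsymm hPQ hdefP hdefQ hadj

/-- **The Hodge conjecture for all powers `A^{N+1}` of an abelian variety of Ribet type `(32, 35)` — UNCONDITIONAL.**
[cite: Ribet1983, Thm. 3] [cite: Deligne2000, §1] -/
theorem hodgeConjectureFor_powSucc_of_ribetTypeThirtyTwoThirtyFive (A : AbelianVariety ℂ) (φ : A ⟶ A)
    {d : ℕ} (hd : 0 < d) (hφ : φ ≫ φ = -(d • 𝟙 A)) (hE2 : Module.finrank ℚ A.endAlgebra = 2)
    (h32 : eigenMultiplicity A φ (Complex.I * (Real.sqrt d : ℂ)) = 32)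
    (h35 : eigenMultiplicity A φ (-(Complex.I * (Real.sqrt d : ℂ))) = 35) (N : ℕ) :
    HodgeConjectureFor (A.powSucc N).dim (A.powSucc N).X :=
  hodgeConjectureFor_of_isDivisorGenerated _
    (AbelianVariety.isDivisorGenerated_powSucc_of_ribetTypeThirtyTwoThirtyFive A φ hd hφ hE2 h32 h35 N)

/-- **67-FOLDS of signature `{32, 35}`: `B• = D•` on all powers — UNCONDITIONAL** (either eigenvalue may carry the `32`).
[cite: Ribet1983, Thm. 0 and Thm. 3] [cite: MoonenZarhin1999LowDim, §2 (2.4)] -/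
theorem AbelianVariety.isDivisorGenerated_powSucc_of_sixtysevenfold_thirtyTwoThirtyFive (A : AbelianVariety ℂ)
    (φ : A ⟶ A) {d : ℕ} (hd : 0 < d) (hφ : φ ≫ φ = -(d • 𝟙 A)) (hE2 : Module.finrank ℚ A.endAlgebra = 2)
    (hX : A.dim = 67)
    (h32 : eigenMultiplicity A φ (Complex.I * (Real.sqrt d : ℂ)) = 32 ∨
      eigenMultiplicity A φ (-(Complex.I * (Real.sqrt d : ℂ))) = 32)
    (N : ℕ) : IsDivisorGenerated (A.powSucc N) := by
  have hsum := eigenMultiplicity_add_eigenMultiplicity_neg_eq_dim A φ hd hφ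
  rw [hX] at hsum
  rcases h32 with h | h
  · exact AbelianVariety.isDivisorGenerated_powSucc_of_ribetTypeThirtyTwoThirtyFive A φ hd hφ hE2 h (by omega) N
  · exact AbelianVariety.isDivisorGenerated_powSucc_of_ribetTypeThirtyTwoThirtyFive' A φ hd hφ hE2 (by omega) h N

/-- **The Hodge conjecture for all powers of a 67-FOLD of signature `{32, 35}` — UNCONDITIONAL.**
[cite: Ribet1983, Thm. 3] [cite: Deligne2000, §1] -/
theorem hodgeConjectureFor_powSucc_of_sixtysevenfold_thirtyTwoThirtyFive (A : AbelianVariety ℂ)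
    (φ : A ⟶ A) {d : ℕ} (hd : 0 < d) (hφ : φ ≫ φ = -(d • 𝟙 A)) (hE2 : Module.finrank ℚ A.endAlgebra = 2)
    (hX : A.dim = 67)
    (h32 : eigenMultiplicity A φ (Complex.I * (Real.sqrt d : ℂ)) = 32 ∨
      eigenMultiplicity A φ (-(Complex.I * (Real.sqrt d : ℂ))) = 32)
    (N : ℕ) : HodgeConjectureFor (A.powSucc N).dim (A.powSucc N).X :=
  hodgeConjectureFor_of_isDivisorGenerated _
    (AbelianVariety.isDivisorGenerated_powSucc_of_sixtysevenfold_thirtyTwoThirtyFive A φ hd hφ hE2 hX h32 N)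

/-- **Ribet 1983 Thm. 3 at `(n′, n″) = (33, 34)` — UNCONDITIONAL** (core `UnitaryThirtyThreeThirtyFour.eq_top_of_smul`).
[cite: Ribet1983, Thm. 0 and Thm. 3] [cite: Gordon1997, Thm. 6.3 (3) and Corollary] -/
theorem AbelianVariety.isDivisorGenerated_powSucc_of_ribetTypeThirtyThreeThirtyFour (A : AbelianVariety ℂ) (φ : A ⟶ A)
    {d : ℕ} (hd : 0 < d) (hφ : φ ≫ φ = -(d • 𝟙 A)) (hE2 : Module.finrank ℚ A.endAlgebra = 2)
    (h33 : eigenMultiplicity A φ (Complex.I * (Real.sqrt d : ℂ)) = 33)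
    (h34 : eigenMultiplicity A φ (-(Complex.I * (Real.sqrt d : ℂ))) = 34) (N : ℕ) :
    IsDivisorGenerated (A.powSucc N) := by
  refine AbelianVariety.isDivisorGenerated_powSucc_of_ribetType_ofCoreSmul A φ hd hφ hE2 (by omega) (by omega) ?_ N
  intro W' _ _ _ 𝔊 ι P' Q' s hbr hirr hι hιι hP' hQ' hfinP' hfinQ' hadd hsmul hsymm hPQ hdefP hdefQ hadj
  exact UnitaryThirtyThreeThirtyFour.eq_top_of_smul hbr hirr hι hιι hP' hQ' (by rw [hfinP', h33]) (by rw [hfinQ', h34]) hadd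
    hsmul hsymm hPQ hdefP hdefQ hadj

/-- The mirror: `n_{i√d}(φ) = 34`, `n_{−i√d}(φ) = 33` (core `UnitaryThirtyThreeThirtyFour.eq_top_of_smul'`).
[cite: Ribet1983, Thm. 0 and Thm. 3] [cite: Gordon1997, Thm. 6.3 (3) and Corollary] -/
theorem AbelianVariety.isDivisorGenerated_powSucc_of_ribetTypeThirtyThreeThirtyFour' (A : AbelianVariety ℂ) (φ : A ⟶ A)
    {d : ℕ} (hd : 0 < d) (hφ : φ ≫ φ = -(d • 𝟙 A)) (hE2 : Module.finrank ℚ A.endAlgebra = 2)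
    (h34 : eigenMultiplicity A φ (Complex.I * (Real.sqrt d : ℂ)) = 34)
    (h33 : eigenMultiplicity A φ (-(Complex.I * (Real.sqrt d : ℂ))) = 33) (N : ℕ) :
    IsDivisorGenerated (A.powSucc N) := by
  refine AbelianVariety.isDivisorGenerated_powSucc_of_ribetType_ofCoreSmul A φ hd hφ hE2 (by omega) (by omega) ?_ N
  intro W' _ _ _ 𝔊 ι P' Q' s hbr hirr hι hιι hP' hQ' hfinP' hfinQ' hadd hsmul hsymm hPQ hdefP hdefQ hadj
  exact UnitaryThirtyThreeThirtyFour.eq_top_of_smul' hbr hirr hι hιι hP' hQ' (by rw [hfinP', h34]) (by rw [hfinQ', h33])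
    hadd hsmul hsymm hPQ hdefP hdefQ hadj

/-- **The Hodge conjecture for all powers `A^{N+1}` of an abelian variety of Ribet type `(33, 34)` — UNCONDITIONAL.**
[cite: Ribet1983, Thm. 3] [cite: Deligne2000, §1] -/
theorem hodgeConjectureFor_powSucc_of_ribetTypeThirtyThreeThirtyFour (A : AbelianVariety ℂ) (φ : A ⟶ A)
    {d : ℕ} (hd : 0 < d) (hφ : φ ≫ φ = -(d • 𝟙 A)) (hE2 : Module.finrank ℚ A.endAlgebra = 2)
    (h33 : eigenMultiplicity A φ (Complex.I * (Real.sqrt d : ℂ)) = 33)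
    (h34 : eigenMultiplicity A φ (-(Complex.I * (Real.sqrt d : ℂ))) = 34) (N : ℕ) :
    HodgeConjectureFor (A.powSucc N).dim (A.powSucc N).X :=
  hodgeConjectureFor_of_isDivisorGenerated _
    (AbelianVariety.isDivisorGenerated_powSucc_of_ribetTypeThirtyThreeThirtyFour A φ hd hφ hE2 h33 h34 N)

/-- **67-FOLDS of signature `{33, 34}`: `B• = D•` on all powers — UNCONDITIONAL** (either eigenvalue may carry the `33`).
[cite: Ribet1983, Thm. 0 and Thm. 3] [cite: MoonenZarhin1999LowDim, §2 (2.4)] -/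
theorem AbelianVariety.isDivisorGenerated_powSucc_of_sixtysevenfold_thirtyThreeThirtyFour (A : AbelianVariety ℂ)
    (φ : A ⟶ A) {d : ℕ} (hd : 0 < d) (hφ : φ ≫ φ = -(d • 𝟙 A)) (hE2 : Module.finrank ℚ A.endAlgebra = 2)
    (hX : A.dim = 67)
    (h33 : eigenMultiplicity A φ (Complex.I * (Real.sqrt d : ℂ)) = 33 ∨
      eigenMultiplicity A φ (-(Complex.I * (Real.sqrt d : ℂ))) = 33)
    (N : ℕ) : IsDivisorGenerated (A.powSucc N) := by
  have hsum := eigenMultiplicity_add_eigenMultiplicity_neg_eq_dim A φ hd hφ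
  rw [hX] at hsum
  rcases h33 with h | h
  · exact AbelianVariety.isDivisorGenerated_powSucc_of_ribetTypeThirtyThreeThirtyFour A φ hd hφ hE2 h (by omega) N
  · exact AbelianVariety.isDivisorGenerated_powSucc_of_ribetTypeThirtyThreeThirtyFour' A φ hd hφ hE2 (by omega) h N

/-- **The Hodge conjecture for all powers of a 67-FOLD of signature `{33, 34}` — UNCONDITIONAL.**
[cite: Ribet1983, Thm. 3] [cite: Deligne2000, §1] -/
theorem hodgeConjectureFor_powSucc_of_sixtysevenfold_thirtyThreeThirtyFour (A : AbelianVariety ℂ)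
    (φ : A ⟶ A) {d : ℕ} (hd : 0 < d) (hφ : φ ≫ φ = -(d • 𝟙 A)) (hE2 : Module.finrank ℚ A.endAlgebra = 2)
    (hX : A.dim = 67)
    (h33 : eigenMultiplicity A φ (Complex.I * (Real.sqrt d : ℂ)) = 33 ∨
      eigenMultiplicity A φ (-(Complex.I * (Real.sqrt d : ℂ))) = 33)
    (N : ℕ) : HodgeConjectureFor (A.powSucc N).dim (A.powSucc N).X :=
  hodgeConjectureFor_of_isDivisorGenerated _
    (AbelianVariety.isDivisorGenerated_powSucc_of_sixtysevenfold_thirtyThreeThirtyFour A φ hd hφ hE2 hX h33 N)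

end Cells

/-! ### §2 Every simple complex abelian 67-fold with `End⁰ ≠ ℚ` -/

section Final

variable {X : AbelianVariety ℂ}

/-- **`B• = D•` on all powers of a SIMPLE complex abelian `67`-FOLD, granted ONLY the shape `End⁰ = ℚ`.** (The census
`isDivisorGenerated_powSucc_of_isSimple_sixtysevenfold` with all its imaginary-quadratic inputs, the `k`-signatures
`{9, 58}`, `{10, 57}`, `{12, 55}`, `{15, 52}`, `{16, 51}`, `{17, 50}`, `{18, 49}`, `{19, 48}`, `{21, 46}`, `{22, 45}`, `{23, 44}`, `{25, 42}`, `{27, 40}`, `{28, 39}`, `{29, 38}`, `{31, 36}`, `{32, 35}`, `{33, 34}`, supplied by §1.)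
[cite: MoonenZarhin1999LowDim, §2 (2.4) and Thm. (2.7)] [cite: Ribet1983, Thms. 0–3] [cite: Gordon1997, Thm. 6.3 and Corollary] -/
theorem isDivisorGenerated_powSucc_of_isSimple_sixtysevenfold' (hs : X.IsSimple) (hX : X.dim = 67)
    (h1 : Module.finrank ℚ X.endAlgebra = 1 → ∀ N : ℕ, IsDivisorGenerated (X.powSucc N)) (N : ℕ) :
    IsDivisorGenerated (X.powSucc N) := by
  refine isDivisorGenerated_powSucc_of_isSimple_sixtysevenfold hs hX h1 (fun φ d hd hφ he2 h N => ?_) N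
  have hsum := eigenMultiplicity_add_eigenMultiplicity_neg_eq_dim X φ hd hφ
  rw [hX] at hsum
  by_cases h9 : eigenMultiplicity X φ (Complex.I * (Real.sqrt d : ℂ)) = 9 ∨ eigenMultiplicity X φ (-(Complex.I * (Real.sqrt d : ℂ))) = 9
  · exact AbelianVariety.isDivisorGenerated_powSucc_of_sixtysevenfold_nineFiftyEight X φ hd hφ he2 hX h9 N
  by_cases h10 : eigenMultiplicity X φ (Complex.I * (Real.sqrt d : ℂ)) = 10 ∨ eigenMultiplicity X φ (-(Complex.I * (Real.sqrt d : ℂ))) = 10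
  · exact AbelianVariety.isDivisorGenerated_powSucc_of_sixtysevenfold_tenFiftySeven X φ hd hφ he2 hX h10 N
  by_cases h12 : eigenMultiplicity X φ (Complex.I * (Real.sqrt d : ℂ)) = 12 ∨ eigenMultiplicity X φ (-(Complex.I * (Real.sqrt d : ℂ))) = 12
  · exact AbelianVariety.isDivisorGenerated_powSucc_of_sixtysevenfold_twelveFiftyFive X φ hd hφ he2 hX h12 N
  by_cases h15 : eigenMultiplicity X φ (Complex.I * (Real.sqrt d : ℂ)) = 15 ∨ eigenMultiplicity X φ (-(Complex.I * (Real.sqrt d : ℂ))) = 15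
  · exact AbelianVariety.isDivisorGenerated_powSucc_of_sixtysevenfold_fifteenFiftyTwo X φ hd hφ he2 hX h15 N
  by_cases h16 : eigenMultiplicity X φ (Complex.I * (Real.sqrt d : ℂ)) = 16 ∨ eigenMultiplicity X φ (-(Complex.I * (Real.sqrt d : ℂ))) = 16
  · exact AbelianVariety.isDivisorGenerated_powSucc_of_sixtysevenfold_sixteenFiftyOne X φ hd hφ he2 hX h16 N
  by_cases h17 : eigenMultiplicity X φ (Complex.I * (Real.sqrt d : ℂ)) = 17 ∨ eigenMultiplicity X φ (-(Complex.I * (Real.sqrt d : ℂ))) = 17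
  · exact AbelianVariety.isDivisorGenerated_powSucc_of_sixtysevenfold_seventeenFifty X φ hd hφ he2 hX h17 N
  by_cases h18 : eigenMultiplicity X φ (Complex.I * (Real.sqrt d : ℂ)) = 18 ∨ eigenMultiplicity X φ (-(Complex.I * (Real.sqrt d : ℂ))) = 18
  · exact AbelianVariety.isDivisorGenerated_powSucc_of_sixtysevenfold_eighteenFortyNine X φ hd hφ he2 hX h18 N
  by_cases h19 : eigenMultiplicity X φ (Complex.I * (Real.sqrt d : ℂ)) = 19 ∨ eigenMultiplicity X φ (-(Complex.I * (Real.sqrt d : ℂ))) = 19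
  · exact AbelianVariety.isDivisorGenerated_powSucc_of_sixtysevenfold_nineteenFortyEight X φ hd hφ he2 hX h19 N
  by_cases h21 : eigenMultiplicity X φ (Complex.I * (Real.sqrt d : ℂ)) = 21 ∨ eigenMultiplicity X φ (-(Complex.I * (Real.sqrt d : ℂ))) = 21
  · exact AbelianVariety.isDivisorGenerated_powSucc_of_sixtysevenfold_twentyOneFortySix X φ hd hφ he2 hX h21 N
  by_cases h22 : eigenMultiplicity X φ (Complex.I * (Real.sqrt d : ℂ)) = 22 ∨ eigenMultiplicity X φ (-(Complex.I * (Real.sqrt d : ℂ))) = 22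
  · exact AbelianVariety.isDivisorGenerated_powSucc_of_sixtysevenfold_twentyTwoFortyFive X φ hd hφ he2 hX h22 N
  by_cases h23 : eigenMultiplicity X φ (Complex.I * (Real.sqrt d : ℂ)) = 23 ∨ eigenMultiplicity X φ (-(Complex.I * (Real.sqrt d : ℂ))) = 23
  · exact AbelianVariety.isDivisorGenerated_powSucc_of_sixtysevenfold_twentyThreeFortyFour X φ hd hφ he2 hX h23 N
  by_cases h25 : eigenMultiplicity X φ (Complex.I * (Real.sqrt d : ℂ)) = 25 ∨ eigenMultiplicity X φ (-(Complex.I * (Real.sqrt d : ℂ))) = 25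
  · exact AbelianVariety.isDivisorGenerated_powSucc_of_sixtysevenfold_twentyFiveFortyTwo X φ hd hφ he2 hX h25 N
  by_cases h27 : eigenMultiplicity X φ (Complex.I * (Real.sqrt d : ℂ)) = 27 ∨ eigenMultiplicity X φ (-(Complex.I * (Real.sqrt d : ℂ))) = 27
  · exact AbelianVariety.isDivisorGenerated_powSucc_of_sixtysevenfold_twentySevenForty X φ hd hφ he2 hX h27 N
  by_cases h28 : eigenMultiplicity X φ (Complex.I * (Real.sqrt d : ℂ)) = 28 ∨ eigenMultiplicity X φ (-(Complex.I * (Real.sqrt d : ℂ))) = 28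
  · exact AbelianVariety.isDivisorGenerated_powSucc_of_sixtysevenfold_twentyEightThirtyNine X φ hd hφ he2 hX h28 N
  by_cases h29 : eigenMultiplicity X φ (Complex.I * (Real.sqrt d : ℂ)) = 29 ∨ eigenMultiplicity X φ (-(Complex.I * (Real.sqrt d : ℂ))) = 29
  · exact AbelianVariety.isDivisorGenerated_powSucc_of_sixtysevenfold_twentyNineThirtyEight X φ hd hφ he2 hX h29 N
  by_cases h31 : eigenMultiplicity X φ (Complex.I * (Real.sqrt d : ℂ)) = 31 ∨ eigenMultiplicity X φ (-(Complex.I * (Real.sqrt d : ℂ))) = 31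
  · exact AbelianVariety.isDivisorGenerated_powSucc_of_sixtysevenfold_thirtyOneThirtySix X φ hd hφ he2 hX h31 N
  by_cases h32 : eigenMultiplicity X φ (Complex.I * (Real.sqrt d : ℂ)) = 32 ∨ eigenMultiplicity X φ (-(Complex.I * (Real.sqrt d : ℂ))) = 32
  · exact AbelianVariety.isDivisorGenerated_powSucc_of_sixtysevenfold_thirtyTwoThirtyFive X φ hd hφ he2 hX h32 N
  by_cases h33 : eigenMultiplicity X φ (Complex.I * (Real.sqrt d : ℂ)) = 33 ∨ eigenMultiplicity X φ (-(Complex.I * (Real.sqrt d : ℂ))) = 33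
  · exact AbelianVariety.isDivisorGenerated_powSucc_of_sixtysevenfold_thirtyThreeThirtyFour X φ hd hφ he2 hX h33 N
  omega

/-- **`B• = D•` on all powers of EVERY SIMPLE complex abelian `67`-FOLD with `End⁰ ≠ ℚ` — UNCONDITIONAL.**
[cite: MoonenZarhin1999LowDim, §2 (2.4) and Thm. (2.7)] [cite: Ribet1983, Thms. 0–3] -/
theorem isDivisorGenerated_powSucc_of_isSimple_sixtysevenfold_of_finrank_endAlgebra_ne_one (hs : X.IsSimple)
    (hX : X.dim = 67) (hne : Module.finrank ℚ X.endAlgebra ≠ 1) (N : ℕ) : IsDivisorGenerated (X.powSucc N) :=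
  isDivisorGenerated_powSucc_of_isSimple_sixtysevenfold' hs hX (fun h => absurd h hne) N

/-- **The Hodge conjecture for all powers of EVERY SIMPLE complex abelian `67`-FOLD with `End⁰ ≠ ℚ` —
UNCONDITIONAL.** [cite: MoonenZarhin1999LowDim, §2 Thm. (2.7)] [cite: Ribet1983, Thm. 3] [cite: Deligne2000, §1] -/
theorem hodgeConjectureFor_powSucc_of_isSimple_sixtysevenfold_of_finrank_endAlgebra_ne_one (hs : X.IsSimple)
    (hX : X.dim = 67) (hne : Module.finrank ℚ X.endAlgebra ≠ 1) (N : ℕ) :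
    HodgeConjectureFor (X.powSucc N).dim (X.powSucc N).X :=
  hodgeConjectureFor_of_isDivisorGenerated _
    (isDivisorGenerated_powSucc_of_isSimple_sixtysevenfold_of_finrank_endAlgebra_ne_one hs hX hne N)

end Final

end Literature.AlgebraicGeometry.HodgeTheory

end

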